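import Literature.NumberTheory.Sieve.SieveFramework
import Mathlib.Data.Finset.NatDivisors
import Mathlib.Algebra.Order.Field.GeomSum
import HarnessLib

/-!
# The Fundamental Lemma of sieve theory via the beta-sieve: proof

Topic `Literature/NumberTheory/Sieve`, companion file of `SieveFramework.lean`. It DISCHARGES the
named fact `Literature.NumberTheory.Sieve.SieveSequence.fundamental_lemma_uniform` (`SieveFramework.lean`):

  for all `κ, K` there is `C = C(κ, K) > 0` such that for every sifted sequence `𝒜` with density of
  dimension `κ` (constant `K`, condition `Ω(κ)` = `HasSieveDimension`), all `x`, all `2 ≤ z ≤ D`,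
  `|S(𝒜, z; x) − X V(z)| ≤ C X V(z) e^{−s} + ∑_{d ∣ P(z), d ≤ D} |R_d(x)|`, `s = log D / log z`

(`SieveSequence.fundamental_lemma_uniform_holds`, with the explicit constant `flConst`), and hence
also the per-sequence named fact `Literature.NumberTheory.Sieve.SieveSequence.fundamental_lemma`
(`SieveSequence.fundamental_lemma_holds`). Everything is proved from Mathlib; no new facts are
introduced.

We follow Greaves, *Sieves in Number Theory* (2001), §3.1 and §3.3 (Brun's sieve in Rosser's form,
i.e. the beta-sieve of Friedlander–Iwaniec, *Opera de Cribro*, whose Lemma 6.8 / Thm 6.9 /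
Cor 6.10 are the results cited by the fact; the held source actually followed, with verified
locators, is Greaves), with the admissible choice `b = 9`, `β = 9κ + 1`:

* `BetaSieve.pred par β D` — Rosser's truncation sets `𝒟^±` (Greaves §3.3.1, (1.1)): a squarefree
  `d = p₁ ⋯ p_r` (`p₁ > ⋯ > p_r`) is kept iff `p₁ ⋯ p_m · p_m^β < D` for all `m ≤ r` of the parity
  `par` (`par = 1`: upper sieve, `par = 0`: lower sieve), defined by recursion on
  `d ↦ d / minFac d`;
  `BetaSieve.ind` is its indicator `χ` and `BetaSieve.bdry` the boundary indicator
  `χ̄(t) = χ(t/q(t)) − χ(t)` (Greaves §3.1.2, (2.12)–(2.13));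
* the fundamental sieve inequalities `∑_{d ∣ n} μ(d) χ⁻(d) ≤ [n = 1] ≤ ∑_{d ∣ n} μ(d) χ⁺(d)`
  (Greaves §3.1.2, Lemma 1; `BetaSieve.upper_sieve`, `BetaSieve.lower_sieve`);
* the main-term identity `∑_{d ∣ A} μ χ g = V(A) − ∑_{t ∣ A} μ(t) χ̄(t) g(t) V(A; q(t))`
  (Greaves §3.1.2, (2.15)–(2.16) and §3.1.4, Lemma 4; `BetaSieve.mainTerm_identity`);
* the level and boundary properties of `𝒟^±` (Greaves §3.3.3, Lemmas 2–4, in recursive form: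
  `BetaSieve.weak_cond`, `BetaSieve.log_le_of_pred`, `BetaSieve.lt_level_of_pred`,
  `BetaSieve.bdry_props`);
* the analytic estimate of the boundary sums by Rankin's trick with `λ = 9` and the numerical
  inequality `e^{10/9}/9 ≤ e^{−1}` (Greaves §3.3.2, Lemma 1 and §3.3.4, Lemmas 5–6 with `b = 9`,
  (4.6); `BetaSieve.fiber_bound`, `BetaSieve.bdry_sum_le`);
* the sieve theorem for sifted sequences in the range `s ≥ β = 9κ + 1` (Greaves §3.3.4, Thm 1 and
  Cor 1.1 "The Fundamental Lemma"; Friedlander–Iwaniec Lemma 6.8):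
  `SieveSequence.fundamental_lemma_beta`,
  `|S(𝒜, z; x) − X V(z)| ≤ 2 K^{10} e^{9κ+1−s} X V(z) + ∑_{d ∣ P(z), d ≤ D} |R_d(x)|`;
* the completion to all `s ≥ 1` (`SieveSequence.fundamental_lemma_explicit`): for `1 ≤ s < β` one
  uses `0 ≤ S(𝒜, z) ≤ S(𝒜, z₁)` with `z₁ = D^{1/β}` (or no sifting if `D < 2^β`) and
  `V(z₁) ≤ K β^κ V(z)`; dimensions `κ ≤ 0` / constants `K < 1` are reduced to `max κ 1`, `max K 1`
  by `HasSieveDimension.mono`.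

## References

* G. Greaves, *Sieves in Number Theory*, Ergebnisse 43, Springer (2001), §3.1.2 (Lemmas 1–2,
  (2.12)–(2.16)), §3.1.4 (Lemmas 3–4), §3.3.1 ((1.1)), §3.3.2 (Lemma 1), §3.3.3 (Lemmas 2–4),
  §3.3.4 (Lemmas 5–6, Theorem 1, Corollary 1.1). [Greaves2001]
* J. Friedlander, H. Iwaniec, *Opera de Cribro*, AMS Colloquium Publ. 57 (2010), Lemma 6.8,
  Thm 6.9, Cor 6.10 (the locators recorded with the fact in `SieveFramework.lean`).
  [FriedlanderIwaniecOpera2010]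

## Design notes

* The constant obtained is `C(κ, K) = flConst (max κ 1) (max K 1)` with
  `flConst κ K = e^{9κ+1} (K (9κ+1)^κ (1 + 2K^{10}) + 2K^{10})`; Greaves' Cor 1.1 has the slightly
  better `2 K^{10} e^{9κ−s}` in the range `s > 9κ + 1` (we do not keep the factor `K^{f}/e`).
* The truncation condition is taken strict (`< D`), as in Friedlander–Iwaniec; Greaves (3.3.1.1)
  uses `≤ D`. Only `d < D` on `𝒟^±` (`BetaSieve.lt_level_of_pred`) matters for the statement proved.
-/

open Finset
open scoped ArithmeticFunction.Moebius ArithmeticFunction.omega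

noncomputable section

namespace Literature.NumberTheory.Sieve

namespace BetaSieve

/-! ### Elementary helpers -/

/-- Splitting a sum over the divisors of `d * p`, `p` prime, `p ∤ d`. [folklore] -/
theorem sum_divisors_mul_prime {d p : ℕ} (hp : p.Prime) (hpd : ¬ p ∣ d) (f : ℕ → ℝ) :
    ∑ e ∈ (d * p).divisors, f e = ∑ e ∈ d.divisors, f e + ∑ e ∈ d.divisors, f (e * p) := by
  have hcop : d.Coprime p := (hp.coprime_iff_not_dvd.mpr hpd).symm
  rw [Nat.Coprime.divisors_mul hcop, Finset.sum_map]
  change ∑ x ∈ (d.divisors ×ˢ p.divisors).attach, f (x.val.1 * x.val.2) = _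
  rw [Finset.sum_attach (d.divisors ×ˢ p.divisors) (fun x => f (x.1 * x.2)), Finset.sum_product,
    hp.divisors, ← Finset.sum_add_distrib]
  refine Finset.sum_congr rfl fun e _ => ?_
  rw [Finset.sum_pair hp.one_lt.ne, mul_one]

/-- For squarefree `n > 1` with least prime factor `p`, `p ∤ n / p`. [folklore] -/
theorem not_minFac_dvd_div {n : ℕ} (hn : Squarefree n) (h1 : n ≠ 1) :
    ¬ n.minFac ∣ n / n.minFac := by
  intro h
  have hp := Nat.minFac_prime h1
  have : n.minFac * n.minFac ∣ n := by
    have := Nat.mul_dvd_mul_left n.minFac h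
    rwa [Nat.mul_div_cancel' (Nat.minFac_dvd n)] at this
  exact hp.ne_one (Nat.isUnit_iff.mp (hn _ this))

/-- The prime factors of `n / minFac n` exceed `minFac n` (squarefree `n`). [folklore] -/
theorem minFac_lt_of_mem_primeFactors_div {n : ℕ} (hn : Squarefree n) (h1 : n ≠ 1) {q : ℕ}
    (hq : q ∈ (n / n.minFac).primeFactors) : n.minFac < q := by
  have hqp := Nat.prime_of_mem_primeFactors hq
  have hqd := Nat.dvd_of_mem_primeFactors hq
  rcases (Nat.minFac_le_of_dvd hqp.two_le
    (hqd.trans (Nat.div_dvd_of_dvd (Nat.minFac_dvd n)))).lt_or_eq with h | h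
  · exact h
  · exact absurd (h ▸ hqd) (not_minFac_dvd_div hn h1)

/-- If all prime factors of `d ≠ 0` exceed the prime `p`, then `minFac (d * p) = p`. [folklore] -/
theorem minFac_mul_eq {d p : ℕ} (hp : p.Prime) (hd : d ≠ 0)
    (hlt : ∀ q ∈ d.primeFactors, p < q) : (d * p).minFac = p := by
  have hne : d * p ≠ 1 := fun h => hp.ne_one (Nat.eq_one_of_mul_eq_one_left h)
  have hq := Nat.minFac_prime hne
  apply le_antisymm (Nat.minFac_le_of_dvd hp.two_le (dvd_mul_left p d))
  rcases (Nat.Prime.dvd_mul hq).mp (Nat.minFac_dvd (d * p)) with h | h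
  · exact (hlt _ (Nat.mem_primeFactors.mpr ⟨hq, h, hd⟩)).le
  · exact ((Nat.prime_dvd_prime_iff_eq hq hp).mp h).ge

/-- If all prime factors of `d ≠ 0` exceed the prime `p`, then `p ∤ d`. [folklore] -/
theorem not_dvd_of_lt_primeFactors {d p : ℕ} (hp : p.Prime) (hd : d ≠ 0)
    (hlt : ∀ q ∈ d.primeFactors, p < q) : ¬ p ∣ d := fun h =>
  lt_irrefl p (hlt p (Nat.mem_primeFactors.mpr ⟨hp, h, hd⟩))

/-- The prime factors of `d * p` (`p` prime, `d ≠ 0`) are those of `d` together with `p`.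
[folklore] -/
theorem primeFactors_mul_prime {d p : ℕ} (hp : p.Prime) (hd : d ≠ 0) :
    (d * p).primeFactors = d.primeFactors ∪ {p} := by
  rw [Nat.primeFactors_mul hd hp.ne_zero, hp.primeFactors]

/-- `ω(d p) = ω(d) + 1` for a prime `p ∤ d`, `d ≠ 0`. [folklore] -/
theorem card_primeFactors_mul_prime {d p : ℕ} (hp : p.Prime) (hd : d ≠ 0) (hpd : ¬ p ∣ d) :
    (d * p).primeFactors.card = d.primeFactors.card + 1 := by
  rw [primeFactors_mul_prime hp hd, Finset.card_union_of_disjoint, Finset.card_singleton]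
  rw [Finset.disjoint_singleton_right]
  exact fun h => hpd (Nat.dvd_of_mem_primeFactors h)

/-! ### The beta-sieve truncation sets -/

/-- The beta-sieve truncation predicate (Rosser's choice). For squarefree `d = p₁ ⋯ p_r`,
`p₁ > ⋯ > p_r`, `BetaSieve.pred par β D d` holds iff `p₁ ⋯ p_m · p_m ^ β < D` for every `m ≤ r` with
`m ≡ par (mod 2)`; `par = 1` gives the upper sieve `𝒟⁺`, `par = 0` the lower sieve `𝒟⁻`
(Greaves §3.3.1, (3.3.1.1), with strict inequality). Defined by recursion on removing the
least prime factor. [cite: Greaves2001, §3.3.1 (1.1)] -/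
def pred (par : ℕ) (β D : ℝ) : ℕ → Prop
  | d =>
    if _ : d ≤ 1 then True
    else
      pred par β D (d / d.minFac) ∧
        (d.primeFactors.card % 2 = par % 2 → (d : ℝ) * (d.minFac : ℝ) ^ β < D)
termination_by d => d
decreasing_by exact Nat.div_lt_self (by omega) (Nat.minFac_prime (by omega)).one_lt

variable {par : ℕ} {β D : ℝ}

/-- `d ≤ 1` belongs to both truncation sets. [folklore] -/
theorem pred_of_le_one {d : ℕ} (h : d ≤ 1) : pred par β D d := by
  rw [pred, dif_pos h]; trivial

/-- `1` belongs to both truncation sets (`χ(1) = 1`). [folklore] -/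
theorem pred_one : pred par β D 1 := pred_of_le_one le_rfl

/-- Unfolding the recursive definition of the truncation sets at `d > 1`. [folklore] -/
theorem pred_iff {d : ℕ} (h : 1 < d) :
    pred par β D d ↔ pred par β D (d / d.minFac) ∧
      (d.primeFactors.card % 2 = par % 2 → (d : ℝ) * (d.minFac : ℝ) ^ β < D) := by
  rw [pred, dif_neg (not_le.mpr h)]

/-- Unfolding `pred` at `d * p` when `p` is a prime below all prime factors of `d`. [folklore] -/
theorem pred_mul_iff {d p : ℕ} (hp : p.Prime) (hd : d ≠ 0) (hlt : ∀ q ∈ d.primeFactors, p < q) :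
    pred par β D (d * p) ↔ pred par β D d ∧
      ((d.primeFactors.card + 1) % 2 = par % 2 → ((d * p : ℕ) : ℝ) * (p : ℝ) ^ β < D) := by
  have h1 : 1 < d * p := by
    have := hp.one_lt; have : 1 ≤ d := Nat.one_le_iff_ne_zero.mpr hd; nlinarith
  rw [pred_iff h1, minFac_mul_eq hp hd hlt, Nat.mul_div_cancel _ hp.pos,
    card_primeFactors_mul_prime hp hd (not_dvd_of_lt_primeFactors hp hd hlt)]

/-- The truncation sets are divisor-closed from below: `χ(d p) = 1 ⇒ χ(d) = 1` when `p` is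
below the prime factors of `d`. [folklore] -/
theorem pred_of_pred_mul {d p : ℕ} (hp : p.Prime) (hd : d ≠ 0) (hlt : ∀ q ∈ d.primeFactors, p < q)
    (h : pred par β D (d * p)) : pred par β D d :=
  ((pred_mul_iff hp hd hlt).mp h).1

/-- The weight `χ(d) ∈ {0, 1}`. [folklore] -/
def ind (par : ℕ) (β D : ℝ) (d : ℕ) : ℝ := by
  classical exact if pred par β D d then 1 else 0

/-- `χ(d) = 1` on the truncation set. [folklore] -/
theorem ind_of_pred {d : ℕ} (h : pred par β D d) : ind par β D d = 1 := by
  simp [ind, h]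

/-- `χ(d) = 0` off the truncation set. [folklore] -/
theorem ind_of_not_pred {d : ℕ} (h : ¬ pred par β D d) : ind par β D d = 0 := by
  simp [ind, h]

/-- `χ(1) = 1`. [folklore] -/
theorem ind_one : ind par β D 1 = 1 := ind_of_pred pred_one

/-- `0 ≤ χ(d)`. [folklore] -/
theorem ind_nonneg (d : ℕ) : 0 ≤ ind par β D d := by
  by_cases h : pred par β D d
  · rw [ind_of_pred h]; exact zero_le_one
  · rw [ind_of_not_pred h]

/-- `χ(d) ≤ 1`. [folklore] -/
theorem ind_le_one (d : ℕ) : ind par β D d ≤ 1 := by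
  by_cases h : pred par β D d
  · rw [ind_of_pred h]
  · rw [ind_of_not_pred h]; exact zero_le_one

/-- `|χ(d)| ≤ 1`. [folklore] -/
theorem abs_ind_le_one (d : ℕ) : |ind par β D d| ≤ 1 := by
  rw [abs_of_nonneg (ind_nonneg d)]; exact ind_le_one d

/-- The boundary indicator `χ̄(t) = χ(t / q(t)) − χ(t) ∈ {0,1}` (Greaves (3.1.2.12)): `1` iff
`t / q(t)` is in the truncation set and `t` is not. For `t = 1` it is `0`.
[cite: Greaves2001, §3.1.2 (2.12)–(2.13)] -/
def bdry (par : ℕ) (β D : ℝ) (t : ℕ) : ℝ := by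
  classical exact if pred par β D (t / t.minFac) ∧ ¬ pred par β D t then 1 else 0

/-- `0 ≤ χ̄(t)`. [folklore] -/
theorem bdry_nonneg (t : ℕ) : 0 ≤ bdry par β D t := by
  unfold bdry; split_ifs <;> norm_num

/-- `χ̄(t) ≤ 1`. [folklore] -/
theorem bdry_le_one (t : ℕ) : bdry par β D t ≤ 1 := by
  unfold bdry; split_ifs <;> norm_num

/-- `χ̄(1) = 0` (Greaves' convention, §3.1.2 after (2.13)). [folklore] -/
theorem bdry_one : bdry par β D 1 = 0 := by
  unfold bdry; rw [if_neg]; exact fun h => h.2 pred_one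

/-- `χ(d p) = χ(d) − χ̄(d p)` for `p` below the prime factors of `d`. [folklore] -/
theorem ind_mul_eq {d p : ℕ} (hp : p.Prime) (hd : d ≠ 0) (hlt : ∀ q ∈ d.primeFactors, p < q) :
    ind par β D (d * p) = ind par β D d - bdry par β D (d * p) := by
  have hdiv : d * p / (d * p).minFac = d := by
    rw [minFac_mul_eq hp hd hlt, Nat.mul_div_cancel _ hp.pos]
  unfold bdry
  rw [hdiv]
  by_cases h1 : pred par β D d
  · by_cases h2 : pred par β D (d * p)
    · rw [ind_of_pred h1, ind_of_pred h2, if_neg (fun h => h.2 h2)]; ring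
    · rw [ind_of_pred h1, ind_of_not_pred h2, if_pos ⟨h1, h2⟩]; ring
  · have h2 : ¬ pred par β D (d * p) := fun h => h1 (pred_of_pred_mul hp hd hlt h)
    rw [ind_of_not_pred h1, ind_of_not_pred h2, if_neg (fun h => h1 h.1)]; ring

/-- When `χ̄(d p) ≠ 0` the index `ν(d p) = ν(d) + 1` has the parity `par`. [folklore] -/
theorem bdry_mul_eq_zero_of_parity {d p : ℕ} (hp : p.Prime) (hd : d ≠ 0)
    (hlt : ∀ q ∈ d.primeFactors, p < q) (hpar : (d.primeFactors.card + 1) % 2 ≠ par % 2) :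
    bdry par β D (d * p) = 0 := by
  unfold bdry
  rw [if_neg]
  rintro ⟨h1, h2⟩
  rw [minFac_mul_eq hp hd hlt, Nat.mul_div_cancel _ hp.pos] at h1
  exact h2 ((pred_mul_iff hp hd hlt).mpr ⟨h1, fun h => absurd h hpar⟩)

/-! ### Möbius on squarefree numbers -/

/-- `μ(d) = (−1)^{ω(d)}` for squarefree `d` (in `ℝ`). [folklore] -/
theorem moebius_of_squarefree {d : ℕ} (hd : Squarefree d) :
    (μ d : ℝ) = (-1) ^ d.primeFactors.card := by
  rw [ArithmeticFunction.moebius_apply_of_squarefree hd, ArithmeticFunction.cardFactors_apply,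
    ← List.toFinset_card_of_nodup ((Nat.squarefree_iff_nodup_primeFactorsList hd.ne_zero).mp hd)]
  push_cast
  rfl

/-- `μ(d p) = −μ(d)` for a prime `p ∤ d` (in `ℝ`). [folklore] -/
theorem moebius_mul_prime {d p : ℕ} (hp : p.Prime) (hpd : ¬ p ∣ d) :
    (μ (d * p) : ℝ) = -μ d := by
  have hcop : d.Coprime p := (hp.coprime_iff_not_dvd.mpr hpd).symm
  rw [ArithmeticFunction.isMultiplicative_moebius.map_mul_of_coprime hcop,
    ArithmeticFunction.moebius_apply_prime hp]
  push_cast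
  ring

/-- Facts about divisors `d` of `A / minFac A` for squarefree `A ≠ 1`. [folklore] -/
theorem of_mem_divisors_div {A d : ℕ} (hA : Squarefree A) (h1 : A ≠ 1)
    (hd : d ∈ (A / A.minFac).divisors) :
    d ≠ 0 ∧ (∀ q ∈ d.primeFactors, A.minFac < q) ∧ ¬ A.minFac ∣ d ∧ Squarefree d := by
  have hd' := Nat.dvd_of_mem_divisors hd
  have hA0 : A / A.minFac ≠ 0 := (Nat.mem_divisors.mp hd).2
  have hd0 : d ≠ 0 := fun h => hA0 (Nat.eq_zero_of_zero_dvd (h ▸ hd'))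
  have hlt : ∀ q ∈ d.primeFactors, A.minFac < q := fun q hq =>
    minFac_lt_of_mem_primeFactors_div hA h1 (Nat.primeFactors_mono hd' hA0 hq)
  refine ⟨hd0, hlt, not_dvd_of_lt_primeFactors (Nat.minFac_prime h1) hd0 hlt, ?_⟩
  exact hA.squarefree_of_dvd (hd'.trans (Nat.div_dvd_of_dvd (Nat.minFac_dvd A)))

/-- `(A / q(A)) · q(A) = A`, `q = minFac`. [folklore] -/
theorem div_minFac_mul {A : ℕ} : A / A.minFac * A.minFac = A :=
  Nat.div_mul_cancel (Nat.minFac_dvd A)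

/-! ### The sieve inequalities (Greaves, Lemma 3.1.1) -/

/-- One Buchstab step for the weighted Möbius sum over the divisors of a squarefree `n ≠ 1`:
`∑_{d ∣ n} μ(d) χ(d) = ∑_{d ∣ n/q(n)} μ(d) χ̄(d q(n))`.
[cite: Greaves2001, §3.1.2 Lemma 2, (2.15)] -/
theorem sum_moebius_ind_eq {n : ℕ} (hn : Squarefree n) (h1 : n ≠ 1) :
    ∑ d ∈ n.divisors, (μ d : ℝ) * ind par β D d =
      ∑ d ∈ (n / n.minFac).divisors, (μ d : ℝ) * bdry par β D (d * n.minFac) := by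
  have hp := Nat.minFac_prime h1
  conv_lhs => rw [← div_minFac_mul (A := n)]
  rw [sum_divisors_mul_prime hp (not_minFac_dvd_div hn h1), ← Finset.sum_add_distrib]
  refine Finset.sum_congr rfl fun d hd => ?_
  obtain ⟨hd0, hlt, hpd, -⟩ := of_mem_divisors_div hn h1 hd
  rw [moebius_mul_prime hp hpd, ind_mul_eq hp hd0 hlt]
  ring

/-- **Upper sieve inequality**: `[n = 1] ≤ ∑_{d ∣ n} μ(d) χ⁺(d)` for squarefree `n`.
[cite: Greaves2001, §3.1.2 Lemma 1, (2.4)] -/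
theorem upper_sieve {n : ℕ} (hn : Squarefree n) :
    (if n = 1 then (1 : ℝ) else 0) ≤ ∑ d ∈ n.divisors, (μ d : ℝ) * ind 1 β D d := by
  by_cases h1 : n = 1
  · subst h1; simp [ind_one]
  rw [if_neg h1, sum_moebius_ind_eq hn h1]
  refine Finset.sum_nonneg fun d hd => ?_
  obtain ⟨hd0, hlt, hpd, hsq⟩ := of_mem_divisors_div hn h1 hd
  by_cases hpar : (d.primeFactors.card + 1) % 2 = 1 % 2
  · have heven : Even d.primeFactors.card := by
      rw [Nat.even_iff]; omega
    rw [moebius_of_squarefree hsq, heven.neg_one_pow, one_mul]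
    exact bdry_nonneg _
  · rw [bdry_mul_eq_zero_of_parity (Nat.minFac_prime h1) hd0 hlt hpar, mul_zero]

/-- **Lower sieve inequality**: `∑_{d ∣ n} μ(d) χ⁻(d) ≤ [n = 1]` for squarefree `n`.
[cite: Greaves2001, §3.1.2 Lemma 1, (2.4)] -/
theorem lower_sieve {n : ℕ} (hn : Squarefree n) :
    ∑ d ∈ n.divisors, (μ d : ℝ) * ind 0 β D d ≤ (if n = 1 then (1 : ℝ) else 0) := by
  by_cases h1 : n = 1
  · subst h1; simp [ind_one]
  rw [if_neg h1, sum_moebius_ind_eq hn h1]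
  refine Finset.sum_nonpos fun d hd => ?_
  obtain ⟨hd0, hlt, hpd, hsq⟩ := of_mem_divisors_div hn h1 hd
  by_cases hpar : (d.primeFactors.card + 1) % 2 = 0 % 2
  · have hodd : Odd d.primeFactors.card := by
      rw [Nat.odd_iff]; omega
    rw [moebius_of_squarefree hsq, hodd.neg_one_pow, neg_one_mul, neg_nonpos]
    exact bdry_nonneg _
  · rw [bdry_mul_eq_zero_of_parity (Nat.minFac_prime h1) hd0 hlt hpar, mul_zero]

/-! ### The main-term identity (Greaves, (3.1.2.15)–(3.1.2.16) and Lemma 3.1.4) -/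

variable (g : ArithmeticFunction ℝ)

/-- `V(A) = ∏_{p ∣ A} (1 − g(p))`. [folklore] -/
def vprod (A : ℕ) : ℝ := ∏ p ∈ A.primeFactors, (1 - g p)

/-- `V(A; q) = ∏_{p ∣ A, p < q} (1 − g(p))`, the product over the prime factors of `A` below `q`.
[folklore] -/
def vlt (A : ℕ) (q : ℕ) : ℝ := ∏ p ∈ A.primeFactors.filter (· < q), (1 - g p)

variable {g}

/-- `V(d p) = (1 − g(p)) V(d)` for a prime `p ∤ d`. [folklore] -/
theorem vprod_mul_prime {d p : ℕ} (hp : p.Prime) (hd : d ≠ 0) (hpd : ¬ p ∣ d) :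
    vprod g (d * p) = (1 - g p) * vprod g d := by
  rw [vprod, vprod, primeFactors_mul_prime hp hd, Finset.prod_union, Finset.prod_singleton,
    mul_comm]
  rw [Finset.disjoint_singleton_right]
  exact fun h => hpd (Nat.dvd_of_mem_primeFactors h)

/-- `V(d p; q) = (1 − g(p)) V(d; q)` for a prime `p ∤ d` with `p < q`. [folklore] -/
theorem vlt_mul_prime_of_lt {d p q : ℕ} (hp : p.Prime) (hd : d ≠ 0) (hpd : ¬ p ∣ d) (hpq : p < q) :
    vlt g (d * p) q = (1 - g p) * vlt g d q := by
  rw [vlt, vlt, primeFactors_mul_prime hp hd, Finset.filter_union, Finset.filter_singleton,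
    if_pos hpq, Finset.prod_union, Finset.prod_singleton, mul_comm]
  rw [Finset.disjoint_singleton_right, Finset.mem_filter]
  exact fun h => hpd (Nat.dvd_of_mem_primeFactors h.1)

/-- `V(d p; p) = 1` when `p` is below all prime factors of `d` (empty product). [folklore] -/
theorem vlt_mul_prime_self {d p : ℕ} (hp : p.Prime) (hd : d ≠ 0)
    (hlt : ∀ q ∈ d.primeFactors, p < q) : vlt g (d * p) p = 1 := by
  rw [vlt, primeFactors_mul_prime hp hd]
  refine Finset.prod_eq_one fun q hq => ?_
  rw [Finset.mem_filter, Finset.mem_union, Finset.mem_singleton] at hq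
  rcases hq with ⟨hq | hq, hlt'⟩
  · exact absurd (hlt q hq) (not_lt.mpr hlt'.le)
  · exact absurd hlt' (hq ▸ lt_irrefl p)

/-- **Main-term identity** (Greaves Lemma 3.1.4 in the form (3.1.2.15)–(3.1.2.16) with `ψ = g`):
for squarefree `A` and multiplicative `g`,
`∑_{d ∣ A} μ(d) χ(d) g(d) = V(A) − ∑_{t ∣ A} μ(t) χ̄(t) g(t) V(A; q(t))`.
[cite: Greaves2001, §3.1.2 (2.15)–(2.16) and §3.1.4 Lemma 4] -/
theorem mainTerm_identity (hg : g.IsMultiplicative) {A : ℕ} (hA : Squarefree A) :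
    ∑ d ∈ A.divisors, (μ d : ℝ) * ind par β D d * g d =
      vprod g A - ∑ t ∈ A.divisors, (μ t : ℝ) * bdry par β D t * g t * vlt g A t.minFac := by
  induction A using Nat.strong_induction_on with
  | _ A ih =>
    by_cases h1 : A = 1
    · subst h1
      simp [vprod, ind_one, bdry_one, hg.map_one]
    have hp := Nat.minFac_prime h1
    have hA' : Squarefree (A / A.minFac) :=
      hA.squarefree_of_dvd (Nat.div_dvd_of_dvd (Nat.minFac_dvd A))
    have hA'0 : A / A.minFac ≠ 0 := hA'.ne_zero
    have hlt : A / A.minFac < A := Nat.div_lt_self (Nat.pos_of_ne_zero hA.ne_zero) hp.one_lt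
    have IH := ih _ hlt hA'
    have hndvd := not_minFac_dvd_div hA h1
    set p := A.minFac with hpdef
    set A' := A / A.minFac with hA'def
    have hAeq : A' * p = A := div_minFac_mul
    rw [← hAeq, sum_divisors_mul_prime hp hndvd, sum_divisors_mul_prime hp hndvd,
      vprod_mul_prime hp hA'0 hndvd]
    -- rewrite the four sums termwise
    have e1 : ∑ d ∈ A'.divisors, (μ (d * p) : ℝ) * ind par β D (d * p) * g (d * p) =
        ∑ d ∈ A'.divisors, (-(g p) * ((μ d : ℝ) * ind par β D d * g d) +
          g p * ((μ d : ℝ) * bdry par β D (d * p) * g d)) := by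
      refine Finset.sum_congr rfl fun d hd => ?_
      obtain ⟨hd0, hlt, hpd, -⟩ := of_mem_divisors_div hA h1 hd
      rw [moebius_mul_prime hp hpd, ind_mul_eq hp hd0 hlt,
        hg.map_mul_of_coprime (hp.coprime_iff_not_dvd.mpr hpd).symm]
      ring
    have e2 : ∑ t ∈ A'.divisors, (μ t : ℝ) * bdry par β D t * g t * vlt g (A' * p) t.minFac =
        ∑ t ∈ A'.divisors, (1 - g p) * ((μ t : ℝ) * bdry par β D t * g t * vlt g A' t.minFac) := by
      refine Finset.sum_congr rfl fun t ht => ?_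
      by_cases ht1 : t = 1
      · subst ht1; simp [bdry_one]
      obtain ⟨ht0, hlt, hpd, -⟩ := of_mem_divisors_div hA h1 ht
      have hq : p < t.minFac :=
        hlt _ (Nat.mem_primeFactors.mpr ⟨Nat.minFac_prime ht1, Nat.minFac_dvd t, ht0⟩)
      rw [vlt_mul_prime_of_lt hp hA'0 hndvd hq]
      ring
    have e3 : ∑ t ∈ A'.divisors, (μ (t * p) : ℝ) * bdry par β D (t * p) * g (t * p) *
          vlt g (A' * p) (t * p).minFac =
        ∑ t ∈ A'.divisors, -(g p * ((μ t : ℝ) * bdry par β D (t * p) * g t)) := by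
      refine Finset.sum_congr rfl fun t ht => ?_
      obtain ⟨ht0, hlt, hpd, -⟩ := of_mem_divisors_div hA h1 ht
      have hltA : ∀ q ∈ A'.primeFactors, p < q := fun q hq =>
        minFac_lt_of_mem_primeFactors_div hA h1 hq
      rw [moebius_mul_prime hp hpd, minFac_mul_eq hp ht0 hlt, vlt_mul_prime_self hp hA'0 hltA,
        hg.map_mul_of_coprime (hp.coprime_iff_not_dvd.mpr hpd).symm]
      ring
    rw [e1, e2, e3, Finset.sum_add_distrib, ← Finset.mul_sum, ← Finset.mul_sum, ← Finset.mul_sum,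
      Finset.sum_neg_distrib, ← Finset.mul_sum, IH]
    ring

/-- The deviation of the sieve main term from `V(A)` is at most
`T(A) = ∑_{t ∣ A} χ̄(t) g(t) V(A; q(t))` (for `g ≥ 0` on the divisors of `A`).
[cite: Greaves2001, §3.1.4 Lemma 4] -/
theorem abs_mainTerm_sub_le (hg : g.IsMultiplicative) {A : ℕ} (hA : Squarefree A)
    (hg0 : ∀ t ∈ A.divisors, 0 ≤ g t) (hv : ∀ q, 0 ≤ vlt g A q) :
    |∑ d ∈ A.divisors, (μ d : ℝ) * ind par β D d * g d - vprod g A| ≤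
      ∑ t ∈ A.divisors, bdry par β D t * g t * vlt g A t.minFac := by
  rw [mainTerm_identity hg hA, sub_sub_cancel_left, abs_neg]
  refine (Finset.abs_sum_le_sum_abs _ _).trans (Finset.sum_le_sum fun t ht => ?_)
  have h0 : 0 ≤ bdry par β D t * g t * vlt g A t.minFac :=
    mul_nonneg (mul_nonneg (bdry_nonneg t) (hg0 t ht)) (hv _)
  have hμ : |(μ t : ℝ)| ≤ 1 := by exact_mod_cast ArithmeticFunction.abs_moebius_le_one
  calc |(μ t : ℝ) * bdry par β D t * g t * vlt g A t.minFac|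
        = |(μ t : ℝ)| * (bdry par β D t * g t * vlt g A t.minFac) := by
          rw [mul_assoc, mul_assoc, abs_mul, ← mul_assoc, abs_of_nonneg h0]
    _ ≤ 1 * (bdry par β D t * g t * vlt g A t.minFac) := mul_le_mul_of_nonneg_right hμ h0
    _ = _ := one_mul _

/-! ### Size of the truncation sets (Greaves §3.3.3, Lemmas 2–4, in recursive form) -/

section Size

variable {z : ℝ}

/-- `t q^β < D ↔ log t + β log q < log D` for positive naturals `t, q` and `D > 0`. [folklore] -/
theorem log_mul_rpow_lt_iff {t q : ℕ} (ht : t ≠ 0) (hq : q ≠ 0) (hD : 0 < D) :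
    (t : ℝ) * (q : ℝ) ^ β < D ↔ Real.log t + β * Real.log q < Real.log D := by
  have ht' : (0 : ℝ) < t := by exact_mod_cast Nat.pos_of_ne_zero ht
  have hq' : (0 : ℝ) < q := by exact_mod_cast Nat.pos_of_ne_zero hq
  rw [← Real.log_rpow hq', ← Real.log_mul ht'.ne' (Real.rpow_pos_of_pos hq' β).ne',
    Real.log_lt_log_iff (mul_pos ht' (Real.rpow_pos_of_pos hq' β)) hD]

/-- `log t ≤ ν(t) · log z` when all prime factors of the squarefree `t` are `< z`. [folklore] -/
theorem log_le_card_mul_log {t : ℕ} (ht : Squarefree t)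
    (hpz : ∀ p ∈ t.primeFactors, (p : ℝ) < z) :
    Real.log t ≤ t.primeFactors.card * Real.log z := by
  conv_lhs => rw [← Nat.prod_primeFactors_of_squarefree ht]
  push_cast
  rw [Real.log_prod (s := t.primeFactors) (f := fun p : ℕ => (p : ℝ)) fun p hp =>
      (Nat.cast_ne_zero.mpr (Nat.prime_of_mem_primeFactors hp).ne_zero)]
  refine (Finset.sum_le_card_nsmul _ _ (Real.log z) fun p hp => ?_).trans (by rw [nsmul_eq_mul])
  exact (Real.log_le_log (by exact_mod_cast (Nat.prime_of_mem_primeFactors hp).pos) (hpz p hp).le)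

variable (hβ : 1 < β) (hz : 1 < z) (hD1 : 1 < D) (hzD : β * Real.log z ≤ Real.log D)
include hβ hz hD1 hzD

omit hz in
/-- Greaves Lemma 3.3.2 (recursive form): in either truncation set, for `t > 1` with prime factors
`< z ≤ D^{1/β}`, the "weak" condition `(t / q(t)) · q(t)^β < D` holds at the top index.
[cite: Greaves2001, §3.3.3 Lemma 2] -/
theorem weak_cond {t : ℕ} (ht : Squarefree t) (h1 : t ≠ 1)
    (hpz : ∀ p ∈ t.primeFactors, (p : ℝ) < z) (h : pred par β D t) :
    Real.log (t / t.minFac : ℕ) + β * Real.log t.minFac < Real.log D := by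
  have hD : 0 < D := lt_trans zero_lt_one hD1
  have hp := Nat.minFac_prime h1
  have ht0 : t ≠ 0 := ht.ne_zero
  have ht'0 : t / t.minFac ≠ 0 := (Nat.div_pos (Nat.minFac_le (Nat.pos_of_ne_zero ht0)) hp.pos).ne'
  have hqz : (t.minFac : ℝ) < z :=
    hpz _ (Nat.mem_primeFactors.mpr ⟨hp, Nat.minFac_dvd t, ht0⟩)
  have hq1 : (1 : ℝ) < t.minFac := by exact_mod_cast hp.one_lt
  rw [pred_iff (lt_of_le_of_ne (Nat.one_le_iff_ne_zero.mpr ht0) (Ne.symm h1))] at h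
  obtain ⟨h', hc⟩ := h
  by_cases hpar : t.primeFactors.card % 2 = par % 2
  · have := (log_mul_rpow_lt_iff ht0 hp.ne_zero hD).mp (hc hpar)
    have hle : Real.log (t / t.minFac : ℕ) ≤ Real.log t :=
      Real.log_le_log (by exact_mod_cast Nat.pos_of_ne_zero ht'0)
        (by exact_mod_cast Nat.div_le_self t t.minFac)
    linarith
  · -- parity fails at `ν(t)`, so it holds at `ν(t) - 1` for `t' = t / q(t)`
    by_cases h1' : t / t.minFac = 1
    · rw [h1', Nat.cast_one, Real.log_one, zero_add]
      calc β * Real.log t.minFac < β * Real.log z :=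
            mul_lt_mul_of_pos_left (Real.log_lt_log (by linarith) hqz) (by linarith)
        _ ≤ Real.log D := hzD
    · have ht' : Squarefree (t / t.minFac) :=
        ht.squarefree_of_dvd (Nat.div_dvd_of_dvd (Nat.minFac_dvd t))
      have hp' := Nat.minFac_prime h1'
      rw [pred_iff (lt_of_le_of_ne (Nat.one_le_iff_ne_zero.mpr ht'0) (Ne.symm h1'))] at h'
      obtain ⟨-, hc'⟩ := h'
      have hcard : t.primeFactors.card = (t / t.minFac).primeFactors.card + 1 := by
        conv_lhs => rw [← div_minFac_mul (A := t)]
        exact card_primeFactors_mul_prime hp ht'0 (not_minFac_dvd_div ht h1)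
      have hpar' : (t / t.minFac).primeFactors.card % 2 = par % 2 := by omega
      have h2 := (log_mul_rpow_lt_iff ht'0 hp'.ne_zero hD).mp (hc' hpar')
      have hqq : (t.minFac : ℝ) < (t / t.minFac).minFac := by
        exact_mod_cast minFac_lt_of_mem_primeFactors_div ht h1
          (Nat.mem_primeFactors.mpr ⟨hp', Nat.minFac_dvd _, ht'0⟩)
      have : β * Real.log t.minFac < β * Real.log (t / t.minFac).minFac :=
        mul_lt_mul_of_pos_left (Real.log_lt_log (by linarith) hqq) (by linarith)
      linarith

omit hz in
/-- Greaves Lemma 3.3.3 (recursive form): a member `t` of a truncation set with prime factors `< z`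
satisfies `log t ≤ (1 − θ^{ν(t)}) log D`, `θ = 1 − 1/β`. [cite: Greaves2001, §3.3.3 Lemma 3] -/
theorem log_le_of_pred {t : ℕ} (ht : Squarefree t) (hpz : ∀ p ∈ t.primeFactors, (p : ℝ) < z)
    (h : pred par β D t) :
    Real.log t ≤ (1 - (1 - 1 / β) ^ t.primeFactors.card) * Real.log D := by
  induction t using Nat.strong_induction_on with
  | _ t ih =>
    by_cases h1 : t = 1
    · subst h1; simp
    have hp := Nat.minFac_prime h1
    have ht0 : t ≠ 0 := ht.ne_zero
    have ht' : Squarefree (t / t.minFac) :=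
      ht.squarefree_of_dvd (Nat.div_dvd_of_dvd (Nat.minFac_dvd t))
    have ht'0 : t / t.minFac ≠ 0 := ht'.ne_zero
    have hlt : t / t.minFac < t := Nat.div_lt_self (Nat.pos_of_ne_zero ht0) hp.one_lt
    have hpz' : ∀ p ∈ (t / t.minFac).primeFactors, (p : ℝ) < z := fun p hp' =>
      hpz p (Nat.primeFactors_mono (Nat.div_dvd_of_dvd (Nat.minFac_dvd t)) ht0 hp')
    have h1t : 1 < t := lt_of_le_of_ne (Nat.one_le_iff_ne_zero.mpr ht0) (Ne.symm h1)
    have IH := ih _ hlt ht' hpz' ((pred_iff h1t).mp h).1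
    have hw := weak_cond hβ hD1 hzD ht h1 hpz h
    have hcard : t.primeFactors.card = (t / t.minFac).primeFactors.card + 1 := by
      conv_lhs => rw [← div_minFac_mul (A := t)]
      exact card_primeFactors_mul_prime hp ht'0 (not_minFac_dvd_div ht h1)
    have hlogt : Real.log t = Real.log (t / t.minFac : ℕ) + Real.log t.minFac := by
      conv_lhs => rw [← div_minFac_mul (A := t)]
      push_cast
      exact Real.log_mul (by exact_mod_cast ht'0) (by exact_mod_cast hp.ne_zero)
    set N := (t / t.minFac).primeFactors.card with hN
    set θ : ℝ := 1 - 1 / β with hθ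
    set L := Real.log D
    set u := Real.log (t / t.minFac : ℕ)
    set v := Real.log (t.minFac : ℝ)
    rw [hcard, hlogt, pow_succ]
    -- `u + β v < L`, `u ≤ (1 - θ^N) L`; want `u + v ≤ (1 - θ^N θ) L`.
    have hβ0 : (0 : ℝ) < β := by linarith
    have hθ0 : 0 ≤ θ := by
      rw [hθ, sub_nonneg, div_le_one hβ0]; exact hβ.le
    have hv : v < (L - u) / β := by rw [lt_div_iff₀ hβ0]; linarith
    have hθN : 0 ≤ θ ^ N := pow_nonneg hθ0 N
    have key : u + v ≤ u + (L - u) / β := by linarith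
    have : u + (L - u) / β = θ * u + L / β := by rw [hθ]; ring
    rw [this] at key
    have h3 : θ * u ≤ θ * ((1 - θ ^ N) * L) := mul_le_mul_of_nonneg_left IH hθ0
    have h4 : L / β = (1 - θ) * L := by rw [hθ]; ring
    nlinarith [h3, h4, key]

omit hz in
/-- The truncation sets have level `D`: `χ(t) = 1`, `t ∣ P(z)` imply `t < D`.
[cite: Greaves2001, §3.3.3 Lemmas 2–3] -/
theorem lt_level_of_pred {t : ℕ} (ht : Squarefree t) (hpz : ∀ p ∈ t.primeFactors, (p : ℝ) < z)
    (h : pred par β D t) : (t : ℝ) < D := by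
  by_cases h1 : t = 1
  · subst h1; simpa using hD1
  have hL : 0 < Real.log D := Real.log_pos hD1
  have hθ : 0 < (1 - 1 / β) := by
    rw [sub_pos, div_lt_one (by linarith)]; exact hβ
  have hN : 0 < (1 - 1 / β) ^ t.primeFactors.card := pow_pos hθ _
  have := log_le_of_pred hβ hD1 hzD ht hpz h
  have hlt : Real.log t < Real.log D := by nlinarith
  exact (Real.log_lt_log_iff (by exact_mod_cast Nat.pos_of_ne_zero ht.ne_zero)
    (by linarith)).mp hlt

/-- Greaves Lemma 3.3.4 / 3.3.5(ii) (recursive form): on the boundary (`χ(t/q(t)) = 1`, `χ(t) = 0`)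
one has `log q(t) ≥ θ^{ν(t)} log z` and `ν(t) + β > s` where `s = log D / log z`.
[cite: Greaves2001, §3.3.3 Lemma 4 and §3.3.4 Lemma 5(ii)] -/
theorem bdry_props {t : ℕ} (ht : Squarefree t) (hpz : ∀ p ∈ t.primeFactors, (p : ℝ) < z)
    (h' : pred par β D (t / t.minFac)) (h : ¬ pred par β D t) :
    (1 - 1 / β) ^ t.primeFactors.card * Real.log z ≤ Real.log t.minFac ∧
      Real.log D < (t.primeFactors.card + β) * Real.log z := by
  have hD : 0 < D := lt_trans zero_lt_one hD1
  have h1 : t ≠ 1 := fun h1 => h (pred_of_le_one h1.le)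
  have hp := Nat.minFac_prime h1
  have ht0 : t ≠ 0 := ht.ne_zero
  have h1t : 1 < t := lt_of_le_of_ne (Nat.one_le_iff_ne_zero.mpr ht0) (Ne.symm h1)
  have ht' : Squarefree (t / t.minFac) :=
    ht.squarefree_of_dvd (Nat.div_dvd_of_dvd (Nat.minFac_dvd t))
  have ht'0 : t / t.minFac ≠ 0 := ht'.ne_zero
  have hpz' : ∀ p ∈ (t / t.minFac).primeFactors, (p : ℝ) < z := fun p hp' =>
    hpz p (Nat.primeFactors_mono (Nat.div_dvd_of_dvd (Nat.minFac_dvd t)) ht0 hp')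
  have hcard : t.primeFactors.card = (t / t.minFac).primeFactors.card + 1 := by
    conv_lhs => rw [← div_minFac_mul (A := t)]
    exact card_primeFactors_mul_prime hp ht'0 (not_minFac_dvd_div ht h1)
  have hsize := log_le_of_pred hβ hD1 hzD ht' hpz' h'
  -- the condition fails at index `ν(t)`:
  rw [pred_iff h1t, not_and] at h
  have hc := h h'
  rw [Classical.not_imp] at hc
  obtain ⟨-, hc⟩ := hc
  rw [log_mul_rpow_lt_iff ht0 hp.ne_zero hD, not_lt] at hc
  have hlogt : Real.log t = Real.log (t / t.minFac : ℕ) + Real.log t.minFac := by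
    conv_lhs => rw [← div_minFac_mul (A := t)]
    push_cast
    exact Real.log_mul (by exact_mod_cast ht'0) (by exact_mod_cast hp.ne_zero)
  rw [hlogt] at hc
  set N := (t / t.minFac).primeFactors.card with hN
  set θ : ℝ := 1 - 1 / β with hθ
  set L := Real.log D with hL
  set u := Real.log (t / t.minFac : ℕ) with hu
  set v := Real.log (t.minFac : ℝ) with hv
  set l := Real.log z with hl
  have hβ0 : (0 : ℝ) < β := by linarith
  have hθ0 : 0 ≤ θ := by
    rw [hθ, sub_nonneg, div_le_one hβ0]; exact hβ.le
  have hθN : 0 ≤ θ ^ N := pow_nonneg hθ0 N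
  have hl0 : 0 < l := Real.log_pos hz
  rw [hcard]
  constructor
  · -- `(β+1) v ≥ L - u ≥ θ^N L` and `θ^{N+1} l ≤ θ^N L θ/β ≤ θ^N L/(β+1)`
    have h2 : θ ^ N * L ≤ (β + 1) * v := by nlinarith
    have h3 : l ≤ L / β := by rw [le_div_iff₀ hβ0]; linarith
    have h4 : θ / β ≤ 1 / (β + 1) := by
      have h5 : 1 ≤ (β + 1) / β := by rw [le_div_iff₀ hβ0]; linarith
      rw [hθ, div_le_div_iff₀ hβ0 (by linarith)]
      calc (1 - 1 / β) * (β + 1) = (β + 1) - (β + 1) / β := by ring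
        _ ≤ (β + 1) - 1 := by linarith
        _ = 1 * β := by ring
    have hL0 : 0 ≤ L := by
      have := mul_pos hβ0 hl0; linarith
    calc θ ^ (N + 1) * l = θ ^ N * (θ * l) := by ring
      _ ≤ θ ^ N * (θ * (L / β)) := by
          refine mul_le_mul_of_nonneg_left (mul_le_mul_of_nonneg_left h3 hθ0) hθN
      _ = θ ^ N * L * (θ / β) := by ring
      _ ≤ θ ^ N * L * (1 / (β + 1)) := mul_le_mul_of_nonneg_left h4 (mul_nonneg hθN hL0)
      _ = θ ^ N * L / (β + 1) := by ring
      _ ≤ v := by rw [div_le_iff₀ (by linarith)]; linarith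
  · -- `L ≤ u + (β+1) v < N l + (β + 1) l`
    have hu' : u ≤ N * l := log_le_card_mul_log ht' hpz'
    have hqz : (t.minFac : ℝ) < z := hpz _ (Nat.mem_primeFactors.mpr ⟨hp, Nat.minFac_dvd t, ht0⟩)
    have hv' : v < l := Real.log_lt_log (by exact_mod_cast hp.pos) hqz
    have : (β + 1) * v < (β + 1) * l := mul_lt_mul_of_pos_left hv' (by linarith)
    push_cast
    nlinarith

end Size

/-! ### Analytic estimates (Greaves §3.3.2 Lemma 1 and §3.3.4 Lemmas 5–6, via Rankin's trick) -/

section Analytic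

variable {g : ArithmeticFunction ℝ}

/-- `V(P; q') ≤ V(P; q)` for `q ≤ q'` when `0 ≤ g(p) ≤ 1` on the prime factors of `P`. [folklore] -/
theorem vlt_anti {P : ℕ} (h01 : ∀ p ∈ P.primeFactors, 0 ≤ g p ∧ g p ≤ 1) {q q' : ℕ}
    (hqq : q ≤ q') : vlt g P q' ≤ vlt g P q := by
  unfold vlt
  rw [← Finset.prod_filter_mul_prod_filter_not (P.primeFactors.filter (· < q')) (fun p => p < q)]
  have hset : (P.primeFactors.filter (· < q')).filter (fun p => p < q) =
      P.primeFactors.filter (· < q) := by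
    ext p
    simp only [Finset.mem_filter]
    constructor
    · rintro ⟨⟨hp, -⟩, h⟩; exact ⟨hp, h⟩
    · rintro ⟨hp, h⟩; exact ⟨⟨hp, lt_of_lt_of_le h hqq⟩, h⟩
  rw [hset]
  refine mul_le_of_le_one_right (Finset.prod_nonneg fun p hp => ?_)
    (Finset.prod_le_one (fun p hp => ?_) (fun p hp => ?_))
  · exact sub_nonneg.mpr (h01 p (Finset.mem_filter.mp hp).1).2
  · exact sub_nonneg.mpr (h01 p (Finset.mem_filter.mp (Finset.mem_filter.mp hp).1).1).2
  · linarith [(h01 p (Finset.mem_filter.mp (Finset.mem_filter.mp hp).1).1).1]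

/-- `0 ≤ V(P; q)` when `g(p) ≤ 1` on the prime factors of `P`. [folklore] -/
theorem vlt_nonneg {P : ℕ} (h01 : ∀ p ∈ P.primeFactors, 0 ≤ g p ∧ g p ≤ 1) (q : ℕ) :
    0 ≤ vlt g P q :=
  Finset.prod_nonneg fun p hp => sub_nonneg.mpr (h01 p (Finset.mem_filter.mp hp).1).2

/-- `V(P) = V(P; q) · ∏_{p ∣ P, p ≥ q} (1 − g(p))`. [folklore] -/
theorem vprod_eq_vlt_mul {P : ℕ} (q : ℕ) :
    vprod g P = vlt g P q * ∏ p ∈ P.primeFactors.filter (fun p => ¬ p < q), (1 - g p) := by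
  rw [vprod, vlt, Finset.prod_filter_mul_prod_filter_not]

/-- Rankin's trick for elementary symmetric sums: for `f ≥ 0` on `S` and `λ > 0`,
`∑_{T ⊆ S, #T = N} ∏_{i ∈ T} f i ≤ λ^{-N} ∏_{i ∈ S} (1 + λ f i)` (the product form; the weaker
`exp` form is `Literature.NumberTheory.Sieve.BrunPureSieve.esymm_le_inv_pow_mul_exp`, not imported here).
[folklore] -/
theorem sum_powersetCard_prod_le {ι : Type*} [DecidableEq ι] (S : Finset ι) (f : ι → ℝ)
    (hf : ∀ i ∈ S, 0 ≤ f i) {lam : ℝ} (hl : 0 < lam) (N : ℕ) :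
    ∑ T ∈ S.powersetCard N, ∏ i ∈ T, f i ≤ (∏ i ∈ S, (1 + lam * f i)) / lam ^ N := by
  rw [le_div_iff₀ (pow_pos hl N), Finset.prod_one_add, Finset.sum_mul]
  calc ∑ T ∈ S.powersetCard N, (∏ i ∈ T, f i) * lam ^ N
      = ∑ T ∈ S.powersetCard N, ∏ i ∈ T, (lam * f i) := by
        refine Finset.sum_congr rfl fun T hT => ?_
        rw [Finset.prod_mul_distrib, Finset.prod_const, (Finset.mem_powersetCard.mp hT).2, mul_comm]
    _ ≤ ∑ T ∈ S.powerset, ∏ i ∈ T, (lam * f i) := by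
        refine Finset.sum_le_sum_of_subset_of_nonneg
          (fun T hT => Finset.mem_powerset.mpr (Finset.mem_powersetCard.mp hT).1) ?_
        intro T hT _
        exact Finset.prod_nonneg fun i hi =>
          mul_nonneg hl.le (hf i (Finset.mem_powerset.mp hT hi))

/-- The numerical inequality `e^{10/9} / 9 ≤ e^{-1}` (i.e. `a = b⁻¹ e^{1 + 1/b} < e⁻¹` for `b = 9`,
Greaves (3.3.4.6) with `b = 9`). [cite: Greaves2001, §3.3.4 (4.6) and Cor 1.1] -/
theorem exp_ten_ninths_div_nine_le : Real.exp (10 / 9) / 9 ≤ Real.exp (-1) := by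
  have h1 : Real.exp 1 < 2.7182818286 := Real.exp_one_lt_d9
  have h2 : Real.exp (1 / 9) ≤ 19 / 17 := by
    have := Real.exp_le_two_add_div_two_sub (x := 1 / 9) (by norm_num) (by norm_num)
    exact this.trans_eq (by norm_num)
  have h3 : Real.exp (10 / 9) = Real.exp 1 * Real.exp (1 / 9) := by
    rw [← Real.exp_add]; norm_num
  have h4 : Real.exp (-1) = (Real.exp 1)⁻¹ := Real.exp_neg 1
  have he : 0 < Real.exp 1 := Real.exp_pos 1
  have h5 : Real.exp 1 * Real.exp 1 < 2.7182818286 * 2.7182818286 := mul_lt_mul'' h1 h1 he.le he.le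
  have h6 : Real.exp 1 * Real.exp 1 * Real.exp (1 / 9) ≤ 2.7182818286 * 2.7182818286 * (19 / 17) :=
    mul_le_mul h5.le h2 (Real.exp_pos _).le (by norm_num)
  have key : Real.exp 1 * Real.exp 1 * Real.exp (1 / 9) ≤ 9 := h6.trans (by norm_num)
  rw [h3, h4, div_le_iff₀ (by norm_num : (0 : ℝ) < 9)]
  calc Real.exp 1 * Real.exp (1 / 9)
      = (Real.exp 1)⁻¹ * (Real.exp 1 * Real.exp 1 * Real.exp (1 / 9)) := by field_simp
    _ ≤ (Real.exp 1)⁻¹ * 9 := mul_le_mul_of_nonneg_left key (inv_nonneg.mpr he.le)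

end Analytic

section Fiber

variable {g : ArithmeticFunction ℝ} {κ K : ℝ}

/-- A multiplicative `g` on a squarefree `t` is `∏_{p ∣ t} g(p)`. [folklore] -/
theorem map_eq_prod_primeFactors (hg : g.IsMultiplicative) {t : ℕ} (ht : Squarefree t) :
    g t = ∏ p ∈ t.primeFactors, g p := by
  conv_lhs => rw [← Nat.prod_primeFactors_of_squarefree ht]
  exact hg.map_prod_of_subset_primeFactors t t.primeFactors Finset.Subset.rfl

/-- Rankin's trick for squarefree numbers composed of `N` primes from `S`:
`∑_{t ∈ C} g(t) ≤ 9^{-N} ∏_{p ∈ S} (1 + 9 g(p))`. [folklore] -/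
theorem sum_le_rankin (hg : g.IsMultiplicative) (S : Finset ℕ) (hg0 : ∀ p ∈ S, 0 ≤ g p) (N : ℕ)
    (C : Finset ℕ) (hC : ∀ t ∈ C, Squarefree t ∧ t.primeFactors ⊆ S ∧ t.primeFactors.card = N) :
    ∑ t ∈ C, g t ≤ (∏ p ∈ S, (1 + 9 * g p)) / 9 ^ N := by
  have hinj : Set.InjOn (fun t : ℕ => t.primeFactors) C := by
    intro t₁ h₁ t₂ h₂ heq
    have e₁ := Nat.prod_primeFactors_of_squarefree (hC t₁ h₁).1
    have e₂ := Nat.prod_primeFactors_of_squarefree (hC t₂ h₂).1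
    rw [← e₁, ← e₂]
    exact congrArg (fun T : Finset ℕ => ∏ p ∈ T, p) heq
  have h1 : ∑ t ∈ C, g t = ∑ T ∈ C.image (fun t : ℕ => t.primeFactors), ∏ p ∈ T, g p := by
    rw [Finset.sum_image hinj]
    exact Finset.sum_congr rfl fun t ht => map_eq_prod_primeFactors hg (hC t ht).1
  have h2 : C.image (fun t : ℕ => t.primeFactors) ⊆ S.powersetCard N := by
    intro T hT
    obtain ⟨t, ht, hTt⟩ := Finset.mem_image.mp hT
    rw [← hTt]
    exact Finset.mem_powersetCard.mpr ⟨(hC t ht).2.1, (hC t ht).2.2⟩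
  rw [h1]
  calc ∑ T ∈ C.image (fun t : ℕ => t.primeFactors), ∏ p ∈ T, g p
      ≤ ∑ T ∈ S.powersetCard N, ∏ p ∈ T, g p :=
        Finset.sum_le_sum_of_subset_of_nonneg h2 fun T hT _ =>
          Finset.prod_nonneg fun p hp => hg0 p ((Finset.mem_powersetCard.mp hT).1 hp)
    _ ≤ _ := sum_powersetCard_prod_le S (fun p => g p) hg0 (by norm_num) N

/-- `0 ≤ V(P)` when `g(p) ≤ 1` on the prime factors of `P`. [folklore] -/
theorem vprod_nonneg {P : ℕ} (h01 : ∀ p ∈ P.primeFactors, 0 ≤ g p ∧ g p ≤ 1) : 0 ≤ vprod g P :=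
  Finset.prod_nonneg fun p hp => sub_nonneg.mpr (h01 p hp).2

/-- The prime factors of a divisor of `P(z)` are `< z`. [folklore] -/
theorem prime_lt_of_mem_primeFactors_of_dvd {z : ℝ} {t p : ℕ} (ht : t ∣ primesProdBelow z)
    (hp : p ∈ t.primeFactors) : (p : ℝ) < z :=
  (dvd_primesProdBelow_iff (Nat.prime_of_mem_primeFactors hp) z).mp
    ((Nat.dvd_of_mem_primeFactors hp).trans ht)

/-- **Greaves, Lemma 3.3.5(i) with `b = 9`** (via Lemma 3.3.1 and Rankin's trick): the contribution
of the boundary terms with exactly `N` prime factors is at most `V(P(z)) K^{10} a^N`,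
`a = e^{10/9}/9`. [cite: Greaves2001, §3.3.2 Lemma 1 and §3.3.4 Lemma 5(i)] -/
theorem fiber_bound (hg : g.IsMultiplicative) (hdim : HasSieveDimension g κ K) (hκ : 0 < κ)
    {z : ℝ} (hz : 2 ≤ z) (hD1 : 1 < D) (hβ : β = 9 * κ + 1)
    (hzD : β * Real.log z ≤ Real.log D) (N : ℕ) :
    ∑ t ∈ (primesProdBelow z).divisors with t.primeFactors.card = N,
        bdry par β D t * g t * vlt g (primesProdBelow z) t.minFac ≤
      vprod g (primesProdBelow z) * K ^ (10 : ℕ) * (Real.exp (10 / 9) / 9) ^ N := by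
  classical
  set P := primesProdBelow z with hP
  have hPsq : Squarefree P := squarefree_primesProdBelow z
  have hP0 : P ≠ 0 := primesProdBelow_ne_zero z
  have hβ1 : 1 < β := by rw [hβ]; linarith
  have hβ0 : 0 < β := by linarith
  have hz1 : 1 < z := by linarith
  set l := Real.log z with hl
  have hl0 : 0 < l := Real.log_pos hz1
  set θ : ℝ := 1 - 1 / β with hθ
  have hθ0 : 0 < θ := by rw [hθ, sub_pos, div_lt_one hβ0]; exact hβ1
  have hθ1 : θ ≤ 1 := by
    rw [hθ, sub_le_self_iff]; exact div_nonneg zero_le_one hβ0.le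
  have hK1 : 1 ≤ K := hdim.one_le
  have hK0 : 0 < K := lt_of_lt_of_le zero_lt_one hK1
  have h01 : ∀ p ∈ P.primeFactors, 0 ≤ g p ∧ g p ≤ 1 := fun p hp =>
    ⟨(hdim.1 p (Nat.prime_of_mem_primeFactors hp)).1,
      (hdim.1 p (Nat.prime_of_mem_primeFactors hp)).2.le⟩
  have hV0 : 0 ≤ vprod g P := vprod_nonneg h01
  -- the threshold `w = max 2 z^{θ^N}` and the set `S_w` of prime factors of `P(z)` in `[w, z)`
  set w : ℝ := max 2 (Real.exp (θ ^ N * l)) with hw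
  have hw2 : 2 ≤ w := le_max_left _ _
  have hθN1 : θ ^ N ≤ 1 := pow_le_one₀ hθ0.le hθ1
  have hθN0 : 0 < θ ^ N := pow_pos hθ0 N
  have hwz : w ≤ z := by
    refine max_le hz ?_
    calc Real.exp (θ ^ N * l) ≤ Real.exp l := Real.exp_le_exp.mpr (by nlinarith)
      _ = z := Real.exp_log (by linarith)
  have hlogw : θ ^ N * l ≤ Real.log w := by
    calc θ ^ N * l = Real.log (Real.exp (θ ^ N * l)) := (Real.log_exp _).symm
      _ ≤ Real.log w := Real.log_le_log (Real.exp_pos _) (le_max_right _ _)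
  have hlogw0 : 0 < Real.log w := Real.log_pos (by linarith)
  set m : ℕ := ⌈w⌉₊ with hm
  set Sw := P.primeFactors.filter (fun p => ¬ p < m) with hSw
  have hSw_eq : Sw = (Nat.primesBelow ⌈z⌉₊).filter (fun p : ℕ => w ≤ (p : ℝ)) := by
    rw [hSw, hP, primeFactors_primesProdBelow]
    refine Finset.filter_congr fun p _ => ?_
    rw [hm, Nat.lt_ceil, not_lt]
  have hSwP : ∀ p ∈ Sw, p ∈ P.primeFactors := fun p hp => (Finset.mem_filter.mp hp).1
  have hg1 : ∀ p ∈ Sw, g p < 1 := fun p hp =>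
    (hdim.1 p (Nat.prime_of_mem_primeFactors (hSwP p hp))).2
  have hg0 : ∀ p ∈ Sw, 0 ≤ g p := fun p hp => (h01 p (hSwP p hp)).1
  -- the dimension hypothesis on `[w, z)`: `∏ (1 - g p)⁻¹ ≤ K (l / log w)^κ ≤ K e^{N/9}`
  have hratio : (l / Real.log w) ^ κ ≤ Real.exp (N / 9) := by
    have hq : l / Real.log w ≤ (1 / θ) ^ N := by
      rw [div_le_iff₀ hlogw0]
      have h1 : (1 / θ) ^ N * θ ^ N = 1 := by
        rw [← mul_pow, one_div, inv_mul_cancel₀ hθ0.ne', one_pow]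
      calc l = (1 / θ) ^ N * (θ ^ N * l) := by rw [← mul_assoc, h1, one_mul]
        _ ≤ (1 / θ) ^ N * Real.log w :=
          mul_le_mul_of_nonneg_left hlogw (pow_nonneg (one_div_pos.mpr hθ0).le N)
    have hq0 : 0 ≤ l / Real.log w := div_nonneg hl0.le hlogw0.le
    have hθκ : (1 / θ) ^ κ ≤ Real.exp (1 / 9) := by
      rw [Real.rpow_def_of_pos (one_div_pos.mpr hθ0)]
      refine Real.exp_le_exp.mpr ?_
      have hlog : Real.log (1 / θ) ≤ 1 / θ - 1 := Real.log_le_sub_one_of_pos (one_div_pos.mpr hθ0)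
      have hβm : β - 1 ≠ 0 := (sub_pos.mpr hβ1).ne'
      have hid : 1 / θ - 1 = 1 / (β - 1) := by
        rw [hθ]; field_simp; ring
      have hκ9 : κ * (1 / (β - 1)) = 1 / 9 := by
        rw [hβ]; field_simp; ring
      calc Real.log (1 / θ) * κ ≤ (1 / θ - 1) * κ := mul_le_mul_of_nonneg_right hlog hκ.le
        _ = 1 / 9 := by rw [hid, mul_comm, hκ9]
    calc (l / Real.log w) ^ κ ≤ ((1 / θ) ^ N) ^ κ := Real.rpow_le_rpow hq0 hq hκ.le
      _ = ((1 / θ) ^ κ) ^ N := (Real.rpow_pow_comm (one_div_pos.mpr hθ0).le κ N).symm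
      _ ≤ (Real.exp (1 / 9)) ^ N :=
          pow_le_pow_left₀ (Real.rpow_nonneg (one_div_pos.mpr hθ0).le κ) hθκ N
      _ = Real.exp (N / 9) := by rw [← Real.exp_nat_mul]; ring_nf
  have hPi : ∏ p ∈ Sw, (1 - g p)⁻¹ ≤ K * Real.exp (N / 9) := by
    have h1 := hdim.2 w z hw2 hwz
    rw [← hSw_eq] at h1
    exact h1.trans (mul_le_mul_of_nonneg_left hratio hK0.le)
  have hprod_pos : 0 < ∏ p ∈ Sw, (1 - g p)⁻¹ :=
    Finset.prod_pos fun p hp => inv_pos.mpr (sub_pos.mpr (hg1 p hp))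
  -- consequence 1: `G = ∑_{S_w} g p ≤ log K + N/9`
  have hG : ∑ p ∈ Sw, g p ≤ Real.log K + N / 9 := by
    calc ∑ p ∈ Sw, g p ≤ ∑ p ∈ Sw, Real.log ((1 - g p)⁻¹) := by
          refine Finset.sum_le_sum fun p hp => ?_
          rw [Real.log_inv]
          linarith [Real.log_le_sub_one_of_pos (sub_pos.mpr (hg1 p hp))]
      _ = Real.log (∏ p ∈ Sw, (1 - g p)⁻¹) :=
          (Real.log_prod (s := Sw) (f := fun p => (1 - g p)⁻¹) fun p hp =>
            (inv_pos.mpr (sub_pos.mpr (hg1 p hp))).ne').symm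
      _ ≤ Real.log (K * Real.exp (N / 9)) := Real.log_le_log hprod_pos hPi
      _ = Real.log K + N / 9 := by
          rw [Real.log_mul hK0.ne' (Real.exp_pos _).ne', Real.log_exp]
  -- consequence 2: `V(P; m) ≤ V(P) K e^{N/9}`
  have hVw : vlt g P m ≤ vprod g P * (K * Real.exp (N / 9)) := by
    have hV : vprod g P = vlt g P m * ∏ p ∈ Sw, (1 - g p) := vprod_eq_vlt_mul m
    have heq : vlt g P m = vprod g P * ∏ p ∈ Sw, (1 - g p)⁻¹ := by
      rw [hV, mul_assoc, ← Finset.prod_mul_distrib,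
        Finset.prod_eq_one (fun p hp => mul_inv_cancel₀ (sub_pos.mpr (hg1 p hp)).ne'), mul_one]
    rw [heq]
    exact mul_le_mul_of_nonneg_left hPi hV0
  -- Step A: termwise, `χ̄(t) g(t) V(P; q(t)) ≤ V(P; m) [χ̄(t) = 1] g(t)`
  have hgF : ∀ t ∈ P.divisors, 0 ≤ g t := by
    intro t ht
    have htd : t ∣ P := Nat.dvd_of_mem_divisors ht
    rw [map_eq_prod_primeFactors hg (hPsq.squarefree_of_dvd htd)]
    exact Finset.prod_nonneg fun p hp => (h01 p (Nat.primeFactors_mono htd hP0 hp)).1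
  -- facts about boundary terms with `N` prime factors
  have hCfacts : ∀ t ∈ P.divisors, t.primeFactors.card = N →
      pred par β D (t / t.minFac) → ¬ pred par β D t →
        Squarefree t ∧ t.primeFactors ⊆ Sw ∧ m ≤ t.minFac := by
    intro t htP htN hc1 hc2
    have htd : t ∣ P := Nat.dvd_of_mem_divisors htP
    have htsq : Squarefree t := hPsq.squarefree_of_dvd htd
    have h1 : t ≠ 1 := fun h1 => hc2 (pred_of_le_one h1.le)
    have hpz : ∀ p ∈ t.primeFactors, (p : ℝ) < z := fun p hp =>
      prime_lt_of_mem_primeFactors_of_dvd htd hp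
    have hprops := bdry_props hβ1 hz1 hD1 hzD htsq hpz hc1 hc2
    have hmq : m ≤ t.minFac := by
      rw [hm]
      refine Nat.ceil_le.mpr (max_le ?_ ?_)
      · exact_mod_cast (Nat.minFac_prime h1).two_le
      · have hq0 : (0 : ℝ) < t.minFac := by exact_mod_cast (Nat.minFac_prime h1).pos
        calc Real.exp (θ ^ N * l) ≤ Real.exp (Real.log t.minFac) :=
              Real.exp_le_exp.mpr (htN ▸ hprops.1)
          _ = t.minFac := Real.exp_log hq0
    refine ⟨htsq, fun p hp => ?_, hmq⟩
    refine Finset.mem_filter.mpr ⟨Nat.primeFactors_mono htd hP0 hp, not_lt.mpr ?_⟩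
    exact hmq.trans (Nat.minFac_le_of_dvd (Nat.prime_of_mem_primeFactors hp).two_le
      (Nat.dvd_of_mem_primeFactors hp))
  have key : ∀ t ∈ P.divisors.filter (fun t => t.primeFactors.card = N),
      bdry par β D t * g t * vlt g P t.minFac ≤
        vlt g P m * (if pred par β D (t / t.minFac) ∧ ¬ pred par β D t then g t else 0) := by
    intro t ht
    obtain ⟨htP, htN⟩ := Finset.mem_filter.mp ht
    by_cases hc : pred par β D (t / t.minFac) ∧ ¬ pred par β D t
    · rw [if_pos hc]
      have hb : bdry par β D t = 1 := by unfold bdry; rw [if_pos hc]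
      obtain ⟨-, -, hmq⟩ := hCfacts t htP htN hc.1 hc.2
      rw [hb, one_mul, mul_comm]
      exact mul_le_mul_of_nonneg_right (vlt_anti h01 hmq) (hgF t htP)
    · rw [if_neg hc]
      have hb : bdry par β D t = 0 := by unfold bdry; rw [if_neg hc]
      rw [hb, zero_mul, zero_mul, mul_zero]
  have hA : ∑ t ∈ P.divisors with t.primeFactors.card = N, bdry par β D t * g t * vlt g P t.minFac ≤
      vlt g P m * ∑ t ∈ (P.divisors.filter (fun t => t.primeFactors.card = N)).filter
        (fun t => pred par β D (t / t.minFac) ∧ ¬ pred par β D t), g t := by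
    calc ∑ t ∈ P.divisors with t.primeFactors.card = N, bdry par β D t * g t * vlt g P t.minFac
        ≤ ∑ t ∈ P.divisors with t.primeFactors.card = N,
            vlt g P m * (if pred par β D (t / t.minFac) ∧ ¬ pred par β D t then g t else 0) :=
          Finset.sum_le_sum key
      _ = _ := by rw [← Finset.mul_sum, ← Finset.sum_filter]
  -- Step B: Rankin's trick over the subsets of `S_w`
  have hB : ∑ t ∈ (P.divisors.filter (fun t => t.primeFactors.card = N)).filter
        (fun t => pred par β D (t / t.minFac) ∧ ¬ pred par β D t), g t ≤
      (∏ p ∈ Sw, (1 + 9 * g p)) / 9 ^ N := by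
    refine sum_le_rankin hg Sw hg0 N _ fun t ht => ?_
    obtain ⟨htF, hc⟩ := Finset.mem_filter.mp ht
    obtain ⟨htP, htN⟩ := Finset.mem_filter.mp htF
    obtain ⟨htsq, hsub, -⟩ := hCfacts t htP htN hc.1 hc.2
    exact ⟨htsq, hsub, htN⟩
  -- Step C: `∏ (1 + 9 g p) ≤ e^{9 G} ≤ K^9 e^N`
  have hC' : ∏ p ∈ Sw, (1 + 9 * g p) ≤ K ^ (9 : ℕ) * Real.exp N := by
    calc ∏ p ∈ Sw, (1 + 9 * g p) ≤ ∏ p ∈ Sw, Real.exp (9 * g p) := by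
          refine Finset.prod_le_prod (fun p hp => ?_) (fun p hp => ?_)
          · linarith [hg0 p hp]
          · linarith [Real.add_one_le_exp (9 * g p)]
      _ = Real.exp (9 * ∑ p ∈ Sw, g p) := by rw [← Real.exp_sum, Finset.mul_sum]
      _ ≤ Real.exp (9 * (Real.log K + N / 9)) := Real.exp_le_exp.mpr (by linarith)
      _ = K ^ (9 : ℕ) * Real.exp N := by
          rw [mul_add, Real.exp_add, show (9 : ℝ) * Real.log K = (9 : ℕ) * Real.log K by norm_num,
            Real.exp_nat_mul, Real.exp_log hK0]
          ring_nf
  -- assemble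
  have h9 : (0 : ℝ) < 9 ^ N := pow_pos (by norm_num) N
  have hsum0 : 0 ≤ ∑ t ∈ (P.divisors.filter (fun t => t.primeFactors.card = N)).filter
        (fun t => pred par β D (t / t.minFac) ∧ ¬ pred par β D t), g t :=
    Finset.sum_nonneg fun t ht =>
      hgF t (Finset.mem_filter.mp (Finset.mem_filter.mp ht).1).1
  calc ∑ t ∈ P.divisors with t.primeFactors.card = N, bdry par β D t * g t * vlt g P t.minFac
      ≤ _ := hA
    _ ≤ (vprod g P * (K * Real.exp (N / 9))) * ((K ^ (9 : ℕ) * Real.exp N) / 9 ^ N) :=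
        mul_le_mul hVw (hB.trans (div_le_div_of_nonneg_right hC' h9.le)) hsum0
          (mul_nonneg hV0 (mul_nonneg hK0.le (Real.exp_pos _).le))
    _ = vprod g P * K ^ (10 : ℕ) * (Real.exp (10 / 9) / 9) ^ N := by
        rw [div_pow, ← Real.exp_nat_mul, show ((N : ℕ) : ℝ) * (10 / 9 : ℝ) = N / 9 + N by ring,
          Real.exp_add]
        ring

/-- **Greaves, Lemma 3.3.6 with `b = 9`** (the sum `T^±(D, P(z))`): for
`s = log D / log z ≥ β = 9κ + 1`,
`∑_{t ∣ P(z)} χ̄(t) g(t) V(P(z); q(t)) ≤ 2 K^{10} e^{β − s} V(P(z))`.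
[cite: Greaves2001, §3.3.4 Lemma 6] -/
theorem bdry_sum_le (hg : g.IsMultiplicative) (hdim : HasSieveDimension g κ K) (hκ : 0 < κ)
    {z : ℝ} (hz : 2 ≤ z) (hD1 : 1 < D) (hβ : β = 9 * κ + 1)
    (hzD : β * Real.log z ≤ Real.log D) :
    ∑ t ∈ (primesProdBelow z).divisors,
        bdry par β D t * g t * vlt g (primesProdBelow z) t.minFac ≤
      2 * K ^ (10 : ℕ) * Real.exp (β - Real.log D / Real.log z) * vprod g (primesProdBelow z) := by
  set P := primesProdBelow z with hP
  have hPsq : Squarefree P := squarefree_primesProdBelow z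
  have hP0 : P ≠ 0 := primesProdBelow_ne_zero z
  have hβ1 : 1 < β := by rw [hβ]; linarith
  have hz1 : 1 < z := by linarith
  have hl0 : 0 < Real.log z := Real.log_pos hz1
  have hK0 : 0 < K := lt_of_lt_of_le zero_lt_one hdim.one_le
  have h01 : ∀ p ∈ P.primeFactors, 0 ≤ g p ∧ g p ≤ 1 := fun p hp =>
    ⟨(hdim.1 p (Nat.prime_of_mem_primeFactors hp)).1,
      (hdim.1 p (Nat.prime_of_mem_primeFactors hp)).2.le⟩
  have hV0 : 0 ≤ vprod g P := vprod_nonneg h01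
  set s := Real.log D / Real.log z with hs
  have hsβ : β ≤ s := by rwa [hs, le_div_iff₀ hl0]
  set a : ℝ := Real.exp (10 / 9) / 9 with ha
  have ha0 : 0 ≤ a := div_nonneg (Real.exp_pos _).le (by norm_num)
  have ha1 : a ≤ Real.exp (-1) := exp_ten_ninths_div_nine_le
  set M := P.primeFactors.card with hM
  -- fiberwise decomposition by `ν(t)`
  have hmaps : ∀ t ∈ P.divisors, t.primeFactors.card ∈ Finset.range (M + 1) := fun t ht =>
    Finset.mem_range.mpr (Nat.lt_succ_of_le
      (Finset.card_le_card (Nat.primeFactors_mono (Nat.dvd_of_mem_divisors ht) hP0)))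
  rw [← Finset.sum_fiberwise_of_maps_to hmaps]
  -- each fiber is bounded by `[s - β < N] V K^10 a^N`
  have hfib : ∀ N ∈ Finset.range (M + 1),
      ∑ t ∈ P.divisors with t.primeFactors.card = N, bdry par β D t * g t * vlt g P t.minFac ≤
        if s - β < N then vprod g P * K ^ (10 : ℕ) * a ^ N else 0 := by
    intro N _
    by_cases hN : s - β < N
    · rw [if_pos hN]; exact fiber_bound hg hdim hκ hz hD1 hβ hzD N
    · rw [if_neg hN]
      refine (Finset.sum_eq_zero fun t ht => ?_).le
      obtain ⟨htP, htN⟩ := Finset.mem_filter.mp ht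
      suffices hb : bdry par β D t = 0 by rw [hb, zero_mul, zero_mul]
      unfold bdry
      rw [if_neg]
      rintro ⟨hc1, hc2⟩
      have htd : t ∣ P := Nat.dvd_of_mem_divisors htP
      have hprops := bdry_props hβ1 hz1 hD1 hzD (hPsq.squarefree_of_dvd htd)
        (fun p hp => prime_lt_of_mem_primeFactors_of_dvd htd hp) hc1 hc2
      apply hN
      have h2 := hprops.2
      rw [htN] at h2
      rw [hs, sub_lt_iff_lt_add, div_lt_iff₀ hl0]
      linarith
  refine (Finset.sum_le_sum hfib).trans ?_
  rw [← Finset.sum_filter, ← Finset.mul_sum]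
  -- the geometric tail
  have hsb0 : 0 ≤ s - β := sub_nonneg.mpr hsβ
  set N₀ : ℕ := ⌊s - β⌋₊ + 1 with hN₀def
  have hN₀ : s - β < N₀ := by rw [hN₀def]; push_cast; exact Nat.lt_floor_add_one (s - β)
  have he0 : (0 : ℝ) ≤ Real.exp (-1) := (Real.exp_pos _).le
  have he1 : Real.exp (-1) < 1 := by rw [Real.exp_lt_one_iff]; norm_num
  have htail : ∑ N ∈ (Finset.range (M + 1)).filter (fun N : ℕ => s - β < N), a ^ N ≤
      2 * Real.exp (β - s) := by
    calc ∑ N ∈ (Finset.range (M + 1)).filter (fun N : ℕ => s - β < N), a ^ N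
        ≤ ∑ N ∈ (Finset.range (M + 1)).filter (fun N : ℕ => s - β < N), Real.exp (-1) ^ N :=
          Finset.sum_le_sum fun N _ => pow_le_pow_left₀ ha0 ha1 N
      _ ≤ ∑ N ∈ Finset.Ico N₀ (M + 1), Real.exp (-1) ^ N := by
          refine Finset.sum_le_sum_of_subset_of_nonneg (fun N hN => ?_)
            (fun N _ _ => pow_nonneg he0 N)
          obtain ⟨hNM, hNs⟩ := Finset.mem_filter.mp hN
          refine Finset.mem_Ico.mpr ⟨?_, Finset.mem_range.mp hNM⟩
          rw [hN₀def]
          have : (⌊s - β⌋₊ : ℝ) < N := (Nat.floor_le hsb0).trans_lt hNs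
          exact Nat.succ_le_of_lt (by exact_mod_cast this)
      _ ≤ Real.exp (-1) ^ N₀ / (1 - Real.exp (-1)) := geom_sum_Ico_le_of_lt_one he0 he1
      _ ≤ Real.exp (β - s) / (1 / 2) := by
          refine div_le_div₀ (Real.exp_pos _).le ?_ (by norm_num) ?_
          · rw [← Real.exp_nat_mul, Real.exp_le_exp]; linarith
          · have h2 : (2 : ℝ) ≤ Real.exp 1 := by linarith [Real.add_one_le_exp (1 : ℝ)]
            have : Real.exp (-1) ≤ 1 / 2 := by
              rw [Real.exp_neg, inv_eq_one_div]
              exact one_div_le_one_div_of_le (by norm_num) h2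
            linarith
      _ = 2 * Real.exp (β - s) := by ring
  calc vprod g P * K ^ (10 : ℕ) *
        ∑ N ∈ (Finset.range (M + 1)).filter (fun N : ℕ => s - β < N), a ^ N
      ≤ vprod g P * K ^ (10 : ℕ) * (2 * Real.exp (β - s)) :=
        mul_le_mul_of_nonneg_left htail (mul_nonneg hV0 (pow_nonneg hK0.le _))
    _ = 2 * K ^ (10 : ℕ) * Real.exp (β - s) * vprod g P := by ring

end Fiber

end BetaSieve

/-! ### The combinatorial sieve theorem for sifted sequences (Greaves Thm 3.3.1, Cor 3.3.1.1;
Friedlander–Iwaniec Lemma 6.8 / Theorem 6.9) -/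

namespace SieveSequence

open BetaSieve

variable (A : SieveSequence)

/-- Rearranging a weighted sum of congruence sums:
`∑_{d ∣ P} λ(d) A_d(x) = ∑_{n ≤ x} a_n ∑_{d ∣ (n, P)} λ(d)`.
[folklore] -/
theorem sum_weights_congrSum (lam : ℕ → ℝ) {P : ℕ} (hP : P ≠ 0) (x : ℝ) :
    ∑ d ∈ P.divisors, lam d * A.congrSum d x =
      ∑ n ∈ Ioc 0 ⌊x⌋₊, A.a n * ∑ d ∈ (Nat.gcd n P).divisors, lam d := by
  simp only [congrSum, Finset.sum_filter, Finset.mul_sum]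
  rw [Finset.sum_comm]
  refine Finset.sum_congr rfl fun n _ => ?_
  rw [← Nat.divisors_filter_dvd_of_dvd hP (Nat.gcd_dvd_right n P), Finset.sum_filter]
  refine Finset.sum_congr rfl fun d hd => ?_
  have hdP : d ∣ P := Nat.dvd_of_mem_divisors hd
  by_cases h : d ∣ n
  · rw [if_pos h, if_pos (Nat.dvd_gcd h hdP), mul_comm]
  · rw [if_neg h, if_neg (fun h' => h ((Nat.dvd_gcd_iff.mp h').1)), mul_zero]

/-- `S(𝒜, P; x) = ∑_{n ≤ x} a_n [ (n, P) = 1 ]`. [folklore] -/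
theorem sifted_eq_sum_ite (x : ℝ) (P : ℕ) :
    A.sifted x P = ∑ n ∈ Ioc 0 ⌊x⌋₊, A.a n * (if Nat.gcd n P = 1 then 1 else 0) := by
  rw [sifted, Finset.sum_filter]
  refine Finset.sum_congr rfl fun n _ => ?_
  by_cases h : n.Coprime P
  · rw [if_pos h, if_pos (Nat.Coprime.gcd_eq_one h), mul_one]
  · rw [if_neg h, if_neg (fun h' => h (Nat.coprime_iff_gcd_eq_one.mpr h')), mul_zero]

/-- Upper beta-sieve inequality for the sifting function. [folklore] -/
theorem sifted_le_upperSum {β D : ℝ} (x : ℝ) {P : ℕ} (hP : Squarefree P) :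
    A.sifted x P ≤ ∑ d ∈ P.divisors, ((μ d : ℝ) * ind 1 β D d) * A.congrSum d x := by
  rw [sum_weights_congrSum A _ hP.ne_zero, sifted_eq_sum_ite]
  refine Finset.sum_le_sum fun n _ => mul_le_mul_of_nonneg_left ?_ (A.a_nonneg n)
  exact upper_sieve (hP.squarefree_of_dvd (Nat.gcd_dvd_right n P))

/-- Lower beta-sieve inequality for the sifting function. [folklore] -/
theorem lowerSum_le_sifted {β D : ℝ} (x : ℝ) {P : ℕ} (hP : Squarefree P) :
    ∑ d ∈ P.divisors, ((μ d : ℝ) * ind 0 β D d) * A.congrSum d x ≤ A.sifted x P := by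
  rw [sum_weights_congrSum A _ hP.ne_zero, sifted_eq_sum_ite]
  refine Finset.sum_le_sum fun n _ => mul_le_mul_of_nonneg_left ?_ (A.a_nonneg n)
  exact lower_sieve (hP.squarefree_of_dvd (Nat.gcd_dvd_right n P))

variable {A} {κ K : ℝ}

/-- The weighted sum `∑_{d ∣ P(z)} μ(d)χ(d) A_d(x)` is `X V(z)` up to `2K^{10}e^{β-s} X V(z)` and
the
remainder sum, for either truncation set (Greaves Theorem 3.3.1 with `b = 9`).
[cite: Greaves2001, §3.3.4 Thm 1] -/
theorem abs_weightedSum_sub_le (hdim : HasSieveDimension A.density κ K) (hκ : 0 < κ) (par : ℕ)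
    {β x z D : ℝ} (hz : 2 ≤ z) (hD1 : 1 < D) (hβ : β = 9 * κ + 1)
    (hzD : β * Real.log z ≤ Real.log D) (hX : 0 ≤ A.size x) :
    |∑ d ∈ (primesProdBelow z).divisors, ((μ d : ℝ) * ind par β D d) * A.congrSum d x -
        A.size x * A.densityProduct (primesProdBelow z)| ≤
      2 * K ^ (10 : ℕ) * Real.exp (β - Real.log D / Real.log z) * A.size x *
          A.densityProduct (primesProdBelow z) +
        ∑ d ∈ (primesProdBelow z).divisors.filter (fun d : ℕ => (d : ℝ) ≤ D),
          |A.remainder d x| := by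
  set P := primesProdBelow z with hP
  have hPsq : Squarefree P := squarefree_primesProdBelow z
  have hP0 : P ≠ 0 := primesProdBelow_ne_zero z
  have hβ1 : 1 < β := by rw [hβ]; linarith
  have hz1 : 1 < z := by linarith
  have hg := A.density_mult
  have h01 : ∀ p ∈ P.primeFactors, 0 ≤ A.density p ∧ A.density p ≤ 1 := fun p hp =>
    ⟨(hdim.1 p (Nat.prime_of_mem_primeFactors hp)).1,
      (hdim.1 p (Nat.prime_of_mem_primeFactors hp)).2.le⟩
  have hVdef : A.densityProduct P = vprod A.density P := rfl
  -- split `A_d = g(d) X + R_d`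
  have hsplit : ∑ d ∈ P.divisors, ((μ d : ℝ) * ind par β D d) * A.congrSum d x =
      A.size x * ∑ d ∈ P.divisors, (μ d : ℝ) * ind par β D d * A.density d +
        ∑ d ∈ P.divisors, ((μ d : ℝ) * ind par β D d) * A.remainder d x := by
    rw [Finset.mul_sum, ← Finset.sum_add_distrib]
    refine Finset.sum_congr rfl fun d _ => ?_
    rw [remainder]
    ring
  -- main term
  have hg0 : ∀ t ∈ P.divisors, 0 ≤ A.density t := by
    intro t ht
    have htd : t ∣ P := Nat.dvd_of_mem_divisors ht
    rw [map_eq_prod_primeFactors hg (hPsq.squarefree_of_dvd htd)]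
    exact Finset.prod_nonneg fun p hp => (h01 p (Nat.primeFactors_mono htd hP0 hp)).1
  have hmain : |∑ d ∈ P.divisors, (μ d : ℝ) * ind par β D d * A.density d - vprod A.density P| ≤
      2 * K ^ (10 : ℕ) * Real.exp (β - Real.log D / Real.log z) * vprod A.density P :=
    (abs_mainTerm_sub_le hg hPsq hg0 (vlt_nonneg h01)).trans
      (bdry_sum_le hg hdim hκ hz hD1 hβ hzD)
  -- remainder term
  have hrem : |∑ d ∈ P.divisors, ((μ d : ℝ) * ind par β D d) * A.remainder d x| ≤
      ∑ d ∈ P.divisors.filter (fun d : ℕ => (d : ℝ) ≤ D), |A.remainder d x| := by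
    rw [Finset.sum_filter]
    refine (Finset.abs_sum_le_sum_abs _ _).trans (Finset.sum_le_sum fun d hd => ?_)
    by_cases hpred : pred par β D d
    · have hdd : d ∣ P := Nat.dvd_of_mem_divisors hd
      have hlt : (d : ℝ) < D := lt_level_of_pred hβ1 hD1 hzD (hPsq.squarefree_of_dvd hdd)
        (fun p hp => prime_lt_of_mem_primeFactors_of_dvd hdd hp) hpred
      rw [if_pos hlt.le, abs_mul, abs_mul]
      have hμ : |(μ d : ℝ)| ≤ 1 := by exact_mod_cast ArithmeticFunction.abs_moebius_le_one
      calc |(μ d : ℝ)| * |ind par β D d| * |A.remainder d x| ≤ 1 * 1 * |A.remainder d x| := by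
            gcongr
            · exact abs_ind_le_one d
        _ = |A.remainder d x| := by ring
    · rw [ind_of_not_pred hpred, mul_zero, zero_mul, abs_zero]
      split_ifs
      · exact abs_nonneg _
      · exact le_rfl
  -- combine
  rw [hsplit, hVdef]
  have hXmain : |A.size x * ∑ d ∈ P.divisors, (μ d : ℝ) * ind par β D d * A.density d -
      A.size x * vprod A.density P| ≤
      2 * K ^ (10 : ℕ) * Real.exp (β - Real.log D / Real.log z) * A.size x * vprod A.density P := by
    rw [← mul_sub, abs_mul, abs_of_nonneg hX]
    calc A.size x * |∑ d ∈ P.divisors, (μ d : ℝ) * ind par β D d * A.density d - vprod A.density P|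
        ≤ A.size x *
            (2 * K ^ (10 : ℕ) * Real.exp (β - Real.log D / Real.log z) * vprod A.density P) :=
          mul_le_mul_of_nonneg_left hmain hX
      _ = _ := by ring
  calc |A.size x * ∑ d ∈ P.divisors, (μ d : ℝ) * ind par β D d * A.density d +
          ∑ d ∈ P.divisors, ((μ d : ℝ) * ind par β D d) * A.remainder d x -
          A.size x * vprod A.density P|
      = |(A.size x * ∑ d ∈ P.divisors, (μ d : ℝ) * ind par β D d * A.density d -
          A.size x * vprod A.density P) +
          ∑ d ∈ P.divisors, ((μ d : ℝ) * ind par β D d) * A.remainder d x| := by ring_nf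
    _ ≤ _ := (abs_add_le _ _).trans (add_le_add hXmain hrem)

/-- **The Fundamental Lemma in the range `s ≥ β = 9κ + 1`** (Greaves, *Sieves in Number Theory*,
Thm 3.3.1 and Cor 3.3.1.1; Friedlander–Iwaniec, *Opera de Cribro*, Lemma 6.8 and Thm 6.9):
for a sifted sequence of dimension `κ > 0` (constant `K`), `z ≥ 2` and `D ≥ z^{9κ+1}`,
`|S(𝒜, z; x) − X V(z)| ≤ 2 K^{10} e^{9κ+1−s} X V(z) + ∑_{d ∣ P(z), d ≤ D} |R_d(x)|`,
`s = log D / log z`. [cite: Greaves2001, §3.3.4 Thm 1 and Cor 1.1]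
[cite: FriedlanderIwaniecOpera2010, Lemma 6.8 and Thm. 6.9] -/
theorem fundamental_lemma_beta (hdim : HasSieveDimension A.density κ K) (hκ : 0 < κ)
    {x z D : ℝ} (hz : 2 ≤ z) (hD1 : 1 < D)
    (hzD : (9 * κ + 1) * Real.log z ≤ Real.log D) (hX : 0 ≤ A.size x) :
    |A.sifted x (primesProdBelow z) - A.size x * A.densityProduct (primesProdBelow z)| ≤
      2 * K ^ (10 : ℕ) * Real.exp ((9 * κ + 1) - Real.log D / Real.log z) * A.size x *
          A.densityProduct (primesProdBelow z) +
        ∑ d ∈ (primesProdBelow z).divisors.filter (fun d : ℕ => (d : ℝ) ≤ D),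
          |A.remainder d x| := by
  have hP : Squarefree (primesProdBelow z) := squarefree_primesProdBelow z
  have hup := abs_weightedSum_sub_le hdim hκ 1 hz hD1 rfl hzD hX
  have hlo := abs_weightedSum_sub_le hdim hκ 0 hz hD1 rfl hzD hX
  have h1 := A.sifted_le_upperSum (β := 9 * κ + 1) (D := D) x hP
  have h2 := A.lowerSum_le_sifted (β := 9 * κ + 1) (D := D) x hP
  rw [abs_le] at hup hlo ⊢
  constructor <;> linarith [hup.2, hlo.1]

/-! ### Assembly: the Fundamental Lemma for all `s ≥ 1` -/

variable (A) in
/-- `S(𝒜, P₂; x) ≤ S(𝒜, P₁; x)` for `P₁ ∣ P₂` (fewer sifting primes, `a_n ≥ 0`). [folklore] -/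
theorem sifted_anti (x : ℝ) {P₁ P₂ : ℕ} (h : P₁ ∣ P₂) : A.sifted x P₂ ≤ A.sifted x P₁ := by
  unfold sifted
  refine Finset.sum_le_sum_of_subset_of_nonneg (fun n hn => ?_) (fun n _ _ => A.a_nonneg n)
  rw [Finset.mem_filter] at hn ⊢
  exact ⟨hn.1, hn.2.coprime_dvd_right h⟩

/-- `P(z₁) ∣ P(z₂)` for `z₁ ≤ z₂`. [folklore] -/
theorem primesProdBelow_dvd {z₁ z₂ : ℝ} (h : z₁ ≤ z₂) : primesProdBelow z₁ ∣ primesProdBelow z₂ :=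
  Finset.prod_dvd_prod_of_subset _ _ _ (Nat.primesBelow_mono (Nat.ceil_mono h))

variable (A) in
/-- Monotonicity of the remainder sum in the sifting range. [folklore] -/
theorem remainderSum_mono (x D : ℝ) {P₁ P₂ : ℕ} (h : P₁ ∣ P₂) (hP₂ : P₂ ≠ 0) :
    ∑ d ∈ P₁.divisors.filter (fun d : ℕ => (d : ℝ) ≤ D), |A.remainder d x| ≤
      ∑ d ∈ P₂.divisors.filter (fun d : ℕ => (d : ℝ) ≤ D), |A.remainder d x| :=
  Finset.sum_le_sum_of_subset_of_nonneg
    (Finset.filter_subset_filter _ (Nat.divisors_subset_of_dvd hP₂ h))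
    (fun _ _ _ => abs_nonneg _)

/-- Positivity of `V(P)` under the dimension hypothesis (`g(p) < 1`). [folklore] -/
theorem densityProduct_pos_of_dim (hdim : HasSieveDimension A.density κ K) (P : ℕ) :
    0 < A.densityProduct P :=
  Finset.prod_pos fun p hp => sub_pos.mpr (hdim.1 p (Nat.prime_of_mem_primeFactors hp)).2

/-- `V(w) ≤ K (log z / log w)^κ V(z)` for `2 ≤ w ≤ z`, a restatement of `Ω(κ)`. [folklore] -/
theorem densityProduct_le_of_dim (hdim : HasSieveDimension A.density κ K) {w z : ℝ} (hw : 2 ≤ w)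
    (hwz : w ≤ z) :
    A.densityProduct (primesProdBelow w) ≤
      K * (Real.log z / Real.log w) ^ κ * A.densityProduct (primesProdBelow z) := by
  have hsplit : A.densityProduct (primesProdBelow z) = A.densityProduct (primesProdBelow w) *
      ∏ p ∈ (Nat.primesBelow ⌈z⌉₊).filter (fun p : ℕ => w ≤ (p : ℝ)), (1 - A.density p) := by
    rw [densityProduct, densityProduct, primeFactors_primesProdBelow, primeFactors_primesProdBelow,
      ← Finset.prod_filter_mul_prod_filter_not (Nat.primesBelow ⌈z⌉₊) (fun p : ℕ => (p : ℝ) < w)]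
    congr 1
    · refine Finset.prod_congr ?_ fun _ _ => rfl
      ext p
      simp only [Finset.mem_filter, Nat.mem_primesBelow, Nat.lt_ceil]
      constructor
      · rintro ⟨⟨-, hp⟩, hlt⟩; exact ⟨hlt, hp⟩
      · rintro ⟨hlt, hp⟩; exact ⟨⟨lt_of_lt_of_le hlt hwz, hp⟩, hlt⟩
    · refine Finset.prod_congr ?_ fun _ _ => rfl
      exact Finset.filter_congr fun p _ => not_lt
  have hpos :
      0 < ∏ p ∈ (Nat.primesBelow ⌈z⌉₊).filter (fun p : ℕ => w ≤ (p : ℝ)), (1 - A.density p) :=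
    Finset.prod_pos fun p hp =>
      sub_pos.mpr (hdim.1 p (Nat.prime_of_mem_primesBelow (Finset.mem_filter.mp hp).1)).2
  have hdim2 := hdim.2 w z hw hwz
  have hinv : ∏ p ∈ (Nat.primesBelow ⌈z⌉₊).filter (fun p : ℕ => w ≤ (p : ℝ)), (1 - A.density p)⁻¹ =
      (∏ p ∈ (Nat.primesBelow ⌈z⌉₊).filter (fun p : ℕ => w ≤ (p : ℝ)), (1 - A.density p))⁻¹ :=
    Finset.prod_inv_distrib _
  rw [hinv] at hdim2
  have hV0 : 0 ≤ A.densityProduct (primesProdBelow w) := (densityProduct_pos_of_dim hdim _).le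
  calc A.densityProduct (primesProdBelow w)
      = A.densityProduct (primesProdBelow w) *
          ((∏ p ∈ (Nat.primesBelow ⌈z⌉₊).filter (fun p : ℕ => w ≤ (p : ℝ)), (1 - A.density p))⁻¹ *
          ∏ p ∈ (Nat.primesBelow ⌈z⌉₊).filter (fun p : ℕ => w ≤ (p : ℝ)), (1 - A.density p)) := by
        rw [inv_mul_cancel₀ hpos.ne', mul_one]
    _ ≤ A.densityProduct (primesProdBelow w) * ((K * (Real.log z / Real.log w) ^ κ) *
          ∏ p ∈ (Nat.primesBelow ⌈z⌉₊).filter (fun p : ℕ => w ≤ (p : ℝ)), (1 - A.density p)) :=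
        mul_le_mul_of_nonneg_left (mul_le_mul_of_nonneg_right hdim2 hpos.le) hV0
    _ = K * (Real.log z / Real.log w) ^ κ * A.densityProduct (primesProdBelow z) := by
        rw [hsplit]; ring

/-- `P(2) = 1` (no prime is `< 2`). [folklore] -/
theorem primesProdBelow_two : primesProdBelow 2 = 1 := by
  rw [primesProdBelow, Nat.ceil_ofNat, Nat.primesBelow_two, Finset.prod_empty]

variable (A) in
/-- With no sifting, `S(𝒜, 1; x) = X + R_1(x)`. [folklore] -/
theorem sifted_one_eq (x : ℝ) : A.sifted x 1 = A.size x + A.remainder 1 x := by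
  rw [remainder, congrSum, A.density_mult.map_one, one_mul, sifted_one,
    Finset.filter_true_of_mem fun n _ => one_dvd n]
  ring

/-- The explicit constant `C(κ, K) = e^{9κ+1} (K (9κ+1)^κ (1 + 2K^{10}) + 2K^{10})`. [folklore] -/
def flConst (κ K : ℝ) : ℝ :=
  Real.exp (9 * κ + 1) * (K * (9 * κ + 1) ^ κ * (1 + 2 * K ^ (10 : ℕ)) + 2 * K ^ (10 : ℕ))

/-- `flConst κ K > 0` for `κ ≥ 0`, `K > 0`. [folklore] -/
theorem flConst_pos {κ K : ℝ} (hκ : 0 ≤ κ) (hK : 0 < K) : 0 < flConst κ K := by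
  unfold flConst
  have h1 : 0 < (9 * κ + 1) ^ κ := Real.rpow_pos_of_pos (by linarith) κ
  positivity

/-- Upper bound in the short range `D < z^{9κ+1}` (`1 ≤ s < β`): with
`M₀ = K (9κ+1)^κ (1 + 2K^{10})`,
`S(𝒜, z; x) ≤ M₀ X V(z) + ∑_{d ∣ P(z), d ≤ D} |R_d(x)|`. One uses `S(𝒜, z) ≤ S(𝒜, z₁)` with
`z₁ = D^{1/(9κ+1)}` (or no sifting at all if `D < 2^{9κ+1}`), the `β`-sieve bound at `z₁` (where
`s = β`) and `V(z₁) ≤ K (9κ+1)^κ V(z)` from `Ω(κ)`. [folklore] -/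
theorem sifted_le_of_small_level (hdim : HasSieveDimension A.density κ K) (hκ : 0 < κ)
    {x z D : ℝ} (hz : 2 ≤ z) (hzD : z ≤ D)
    (hsmall : Real.log D < (9 * κ + 1) * Real.log z) (hX : 0 ≤ A.size x) :
    A.sifted x (primesProdBelow z) ≤
      K * (9 * κ + 1) ^ κ * (1 + 2 * K ^ (10 : ℕ)) *
          (A.size x * A.densityProduct (primesProdBelow z)) +
        ∑ d ∈ (primesProdBelow z).divisors.filter (fun d : ℕ => (d : ℝ) ≤ D),
          |A.remainder d x| := by
  have hK1 : 1 ≤ K := hdim.one_le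
  have hz1 : 1 < z := by linarith
  have hD1 : 1 < D := by linarith
  have hl0 : 0 < Real.log z := Real.log_pos hz1
  have hL0 : 0 < Real.log D := Real.log_pos hD1
  have hlL : Real.log z ≤ Real.log D := Real.log_le_log (by linarith) hzD
  have hβ0 : 0 < 9 * κ + 1 := by linarith
  have hP0 : primesProdBelow z ≠ 0 := primesProdBelow_ne_zero z
  have hV0 : 0 < A.densityProduct (primesProdBelow z) := densityProduct_pos_of_dim hdim _
  have hK10 : 1 ≤ K ^ (10 : ℕ) := one_le_pow₀ hK1
  by_cases h2 : 2 ≤ Real.exp (Real.log D / (9 * κ + 1))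
  · -- sieve at `z₁ = D^{1/β} ∈ [2, z]`
    obtain ⟨z₁, hz₁⟩ : ∃ z₁ : ℝ, z₁ = Real.exp (Real.log D / (9 * κ + 1)) := ⟨_, rfl⟩
    rw [← hz₁] at h2
    have hlogz₁ : Real.log z₁ = Real.log D / (9 * κ + 1) := by rw [hz₁, Real.log_exp]
    have hz₁z : z₁ ≤ z := by
      rw [hz₁, ← Real.exp_log (by linarith : 0 < z)]
      exact Real.exp_le_exp.mpr (by rw [div_le_iff₀ hβ0]; linarith)
    have hFL := fundamental_lemma_beta hdim hκ h2 hD1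
      (by rw [hlogz₁, mul_div_cancel₀ _ hβ0.ne']) hX
    have hexp0 : Real.exp ((9 * κ + 1) - Real.log D / Real.log z₁) = 1 := by
      rw [hlogz₁, div_div_cancel₀ hL0.ne', sub_self, Real.exp_zero]
    rw [hexp0, mul_one] at hFL
    have hS₁ := (abs_le.mp hFL).2
    have hV₁ : A.densityProduct (primesProdBelow z₁) ≤
        K * (9 * κ + 1) ^ κ * A.densityProduct (primesProdBelow z) := by
      refine (densityProduct_le_of_dim hdim h2 hz₁z).trans ?_
      rw [hlogz₁]
      have hratio : Real.log z / (Real.log D / (9 * κ + 1)) ≤ 9 * κ + 1 := by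
        rw [div_div_eq_mul_div, div_le_iff₀ hL0]; nlinarith
      have hratio0 : 0 ≤ Real.log z / (Real.log D / (9 * κ + 1)) := by positivity
      have := Real.rpow_le_rpow hratio0 hratio hκ.le
      have hV0' := hV0.le
      gcongr
    have hR₁ := A.remainderSum_mono x D (primesProdBelow_dvd hz₁z) hP0
    have hS := A.sifted_anti x (primesProdBelow_dvd hz₁z)
    have hXV₁ : A.size x * A.densityProduct (primesProdBelow z₁) ≤
        A.size x * (K * (9 * κ + 1) ^ κ * A.densityProduct (primesProdBelow z)) :=
      mul_le_mul_of_nonneg_left hV₁ hX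
    have h3 : (1 + 2 * K ^ (10 : ℕ)) * (A.size x * A.densityProduct (primesProdBelow z₁)) ≤
        (1 + 2 * K ^ (10 : ℕ)) *
          (A.size x * (K * (9 * κ + 1) ^ κ * A.densityProduct (primesProdBelow z))) :=
      mul_le_mul_of_nonneg_left hXV₁ (by positivity)
    linarith
  · -- `D < 2^β`: no sifting at all, `S ≤ S(𝒜, 1) = X + R_1`
    push Not at h2
    have hLβ : Real.log D / (9 * κ + 1) < Real.log 2 := by
      rw [← Real.exp_lt_exp, Real.exp_log (by norm_num : (0 : ℝ) < 2)]; exact h2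
    have hl2 : Real.log z / Real.log 2 ≤ 9 * κ + 1 := by
      rw [div_le_iff₀ (Real.log_pos one_lt_two)]
      rw [div_lt_iff₀ hβ0] at hLβ
      linarith
    -- `1 ≤ K β^κ V(z)` from `Ω(κ)` on `[2, z)`
    have hV₂ : 1 ≤ K * (9 * κ + 1) ^ κ * A.densityProduct (primesProdBelow z) := by
      have h := densityProduct_le_of_dim hdim le_rfl hz
      rw [primesProdBelow_two, densityProduct, Nat.primeFactors_one, Finset.prod_empty] at h
      refine h.trans ?_
      have hratio0 : 0 ≤ Real.log z / Real.log 2 :=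
        div_nonneg hl0.le (Real.log_pos one_lt_two).le
      have := Real.rpow_le_rpow hratio0 hl2 hκ.le
      have hV0' := hV0.le
      gcongr
    have h1R : |A.remainder 1 x| ≤
        ∑ d ∈ (primesProdBelow z).divisors.filter (fun d : ℕ => (d : ℝ) ≤ D),
          |A.remainder d x| := by
      refine Finset.single_le_sum (f := fun d => |A.remainder d x|) (fun _ _ => abs_nonneg _) ?_
      exact Finset.mem_filter.mpr ⟨Nat.one_mem_divisors.mpr hP0, by push_cast; linarith⟩
    have hS1 : A.sifted x (primesProdBelow z) ≤ A.size x + A.remainder 1 x :=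
      (A.sifted_anti x (one_dvd _)).trans_eq (A.sifted_one_eq x)
    have hXV₂ : A.size x * 1 ≤
        A.size x * (K * (9 * κ + 1) ^ κ * A.densityProduct (primesProdBelow z)) :=
      mul_le_mul_of_nonneg_left hV₂ hX
    have h4 : 0 ≤ 2 * K ^ (10 : ℕ) *
        (A.size x * (K * (9 * κ + 1) ^ κ * A.densityProduct (primesProdBelow z))) := by
      have := hV0.le
      positivity
    linarith [le_abs_self (A.remainder 1 x)]

/-- **The Fundamental Lemma for all `s ≥ 1`, explicit constant**: for a sifted sequence of
dimension `κ > 0` with constant `K`, all `x` and `2 ≤ z ≤ D`,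
`|S(𝒜, z; x) − X V(z)| ≤ C(κ, K) X V(z) e^{-s} + ∑_{d ∣ P(z), d ≤ D} |R_d(x)|`, `s = log D / log z`,
with `C(κ, K) = flConst κ K = e^{9κ+1} (K (9κ+1)^κ (1 + 2K^{10}) + 2K^{10})`. The range
`s ≥ 9κ + 1` is `fundamental_lemma_beta` (Greaves Thm 3.3.1 / Friedlander–Iwaniec Lemma 6.8); for
`1 ≤ s < 9κ + 1` one uses `0 ≤ S(𝒜, z) ≤ S(𝒜, z₁)` (`sifted_le_of_small_level`).
[cite: Greaves2001, §3.3.4 Cor 1.1]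
[cite: FriedlanderIwaniecOpera2010, Lemma 6.8, Thm. 6.9 and Cor. 6.10] -/
theorem fundamental_lemma_explicit (hdim : HasSieveDimension A.density κ K) (hκ : 0 < κ)
    {x z D : ℝ} (hz : 2 ≤ z) (hzD : z ≤ D) (hX : 0 ≤ A.size x) :
    |A.sifted x (primesProdBelow z) - A.size x * A.densityProduct (primesProdBelow z)| ≤
      flConst κ K * A.size x * A.densityProduct (primesProdBelow z) *
          Real.exp (-(Real.log D / Real.log z)) +
        ∑ d ∈ (primesProdBelow z).divisors.filter (fun d : ℕ => (d : ℝ) ≤ D),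
          |A.remainder d x| := by
  have hK1 : 1 ≤ K := hdim.one_le
  have hz1 : 1 < z := by linarith
  have hD1 : 1 < D := by linarith
  have hl0 : 0 < Real.log z := Real.log_pos hz1
  have hL0 : 0 < Real.log D := Real.log_pos hD1
  have hβ0 : 0 < 9 * κ + 1 := by linarith
  have hβ1 : 1 ≤ 9 * κ + 1 := by linarith
  have hV0 : 0 < A.densityProduct (primesProdBelow z) := densityProduct_pos_of_dim hdim _
  have hXV : 0 ≤ A.size x * A.densityProduct (primesProdBelow z) := mul_nonneg hX hV0.le
  have hR0 : 0 ≤ ∑ d ∈ (primesProdBelow z).divisors.filter (fun d : ℕ => (d : ℝ) ≤ D),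
      |A.remainder d x| := Finset.sum_nonneg fun _ _ => abs_nonneg _
  have hS0 : 0 ≤ A.sifted x (primesProdBelow z) := Finset.sum_nonneg fun n _ => A.a_nonneg n
  have hβκ : 1 ≤ (9 * κ + 1) ^ κ := Real.one_le_rpow hβ1 hκ.le
  have hK10 : 1 ≤ K ^ (10 : ℕ) := one_le_pow₀ hK1
  have hE0 : 0 < Real.exp (-(Real.log D / Real.log z)) := Real.exp_pos _
  have heβ : 0 < Real.exp (9 * κ + 1) := Real.exp_pos _
  rw [flConst]
  by_cases hcase : (9 * κ + 1) * Real.log z ≤ Real.log D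
  · -- Case `s ≥ β`: the beta-sieve Fundamental Lemma
    have h := fundamental_lemma_beta hdim hκ hz hD1 hcase hX
    rw [sub_eq_add_neg (9 * κ + 1), Real.exp_add] at h
    have h0 : 0 ≤ Real.exp (9 * κ + 1) * (K * (9 * κ + 1) ^ κ * (1 + 2 * K ^ (10 : ℕ))) *
        (A.size x * A.densityProduct (primesProdBelow z)) *
        Real.exp (-(Real.log D / Real.log z)) := by
      have := hV0.le
      positivity
    linarith
  · -- Case `1 ≤ s < β`
    push Not at hcase
    have hup := sifted_le_of_small_level hdim hκ hz hzD hcase hX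
    have hF : 1 ≤ Real.exp (9 * κ + 1) * Real.exp (-(Real.log D / Real.log z)) := by
      rw [← Real.exp_add, ← sub_eq_add_neg]
      refine Real.one_le_exp ?_
      rw [sub_nonneg, div_le_iff₀ hl0]
      exact hcase.le
    have hM1 : 1 ≤ K * (9 * κ + 1) ^ κ * (1 + 2 * K ^ (10 : ℕ)) + 2 * K ^ (10 : ℕ) := by
      have : 1 ≤ K * (9 * κ + 1) ^ κ := by nlinarith
      nlinarith
    have hXVF : A.size x * A.densityProduct (primesProdBelow z) ≤
        A.size x * A.densityProduct (primesProdBelow z) *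
          (Real.exp (9 * κ + 1) * Real.exp (-(Real.log D / Real.log z))) :=
      le_mul_of_one_le_right hXV hF
    have ha : K * (9 * κ + 1) ^ κ * (1 + 2 * K ^ (10 : ℕ)) *
          (A.size x * A.densityProduct (primesProdBelow z)) ≤
        K * (9 * κ + 1) ^ κ * (1 + 2 * K ^ (10 : ℕ)) *
          (A.size x * A.densityProduct (primesProdBelow z)) *
          (Real.exp (9 * κ + 1) * Real.exp (-(Real.log D / Real.log z))) := by
      refine le_mul_of_one_le_right ?_ hF
      have := hV0.le
      positivity
    have hb : 0 ≤ 2 * K ^ (10 : ℕ) * (A.size x * A.densityProduct (primesProdBelow z)) *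
        (Real.exp (9 * κ + 1) * Real.exp (-(Real.log D / Real.log z))) := by
      have := hV0.le
      positivity
    have hc : A.size x * A.densityProduct (primesProdBelow z) *
          (Real.exp (9 * κ + 1) * Real.exp (-(Real.log D / Real.log z))) ≤
        (K * (9 * κ + 1) ^ κ * (1 + 2 * K ^ (10 : ℕ)) + 2 * K ^ (10 : ℕ)) *
          (A.size x * A.densityProduct (primesProdBelow z) *
            (Real.exp (9 * κ + 1) * Real.exp (-(Real.log D / Real.log z)))) := by
      refine le_mul_of_one_le_left ?_ hM1
      have := hV0.le
      positivity
    rw [abs_le]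
    constructor
    · linarith
    · linarith

/-- **The Fundamental Lemma of sieve theory, uniform form** (`fundamental_lemma_uniform`), proved:
Greaves, *Sieves in Number Theory*, Thm 3.3.1 / Cor 3.3.1.1 (= Friedlander–Iwaniec,
*Opera de Cribro*,
Lemma 6.8, Thm 6.9, Cor 6.10) in the range `s ≥ 9κ + 1`, completed to all `s ≥ 1` by monotonicity
in `z`; constant `C(κ, K) = flConst (max κ 1) (max K 1)`.
[cite: Greaves2001, §3.3.4 Thm 1 and Cor 1.1]
[cite: FriedlanderIwaniecOpera2010, Lemma 6.8, Thm. 6.9 and Cor. 6.10] -/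
theorem fundamental_lemma_uniform_holds : fundamental_lemma_uniform := by
  intro κ K
  refine ⟨flConst (max κ 1) (max K 1),
    flConst_pos (le_trans zero_le_one (le_max_right κ 1))
      (lt_of_lt_of_le zero_lt_one (le_max_right K 1)),
    fun A hA x z D hz hzD hX => ?_⟩
  have hA' : HasSieveDimension A.density (max κ 1) (max K 1) :=
    hA.mono (le_max_left κ 1) (le_max_left K 1)
  exact fundamental_lemma_explicit hA' (lt_of_lt_of_le zero_lt_one (le_max_right κ 1)) hz hzD hX

/-- **The Fundamental Lemma for a single sifted sequence** (`SieveSequence.fundamental_lemma` of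
`SieveFramework.lean`), DISCHARGED: immediate from the uniform form
`fundamental_lemma_uniform_holds` (whose constant depends on `κ, K` only).
[cite: Greaves2001, §3.3.4 Thm 1 and Cor 1.1]
[cite: FriedlanderIwaniecOpera2010, Lemma 6.8, Thm. 6.9 and Cor. 6.10] -/
theorem fundamental_lemma_holds : SieveSequence.fundamental_lemma := by
  intro A κ K hA
  obtain ⟨C, hC, h⟩ := fundamental_lemma_uniform_holds κ K
  exact ⟨C, hC, h A hA⟩

end SieveSequence

end Literature.NumberTheory.Sieve
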